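import Mathlib
import HarnessLib
import HarnessLib.Audit
import Summits.Langlands.Statement
import Summits.Langlands.Langlands.Theses.ResidualSplit
import Literature.FieldTheory.AlgClosed.PadicAlgClEquivComplex
import Literature.NumberTheory.PAdicHodge.FontaineDpst
import Literature.NumberTheory.Automorphic.AutomorphicRepsGLSatakeFlathProofs
import Literature.NumberTheory.GaloisRepresentations.ResidualPairIntegrality
import HarnessLib.Audit.Status.Attr

/-!
Route: OdlyzkoWorldSplit

# Route OdlyzkoWorldSplit — Serre_w cut along the archimedean dial — the finite Odlyzko world of
small residual root discriminant plus its generic complement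

Decomposition node of the Langlands root ladder (cell decomp-langlands, lens-5 «finite/base range +
asymptotic regime + bridge», gen 3): a CHILD of
route-Langlands-ResidualSplit (rev 2) at its open residual crux Serre_w =
`ResidualSplit.ResidualAutomorphy` (stmt-Langlands-24015), OR-sibling of
MinimalLevelDescent (conductor dial) and AnchoredFamilySplit (anchor dial). Sort Serre_w instances
(K, ℓ, ρ) by ONE intrinsic, twist-invariant,
ARCHIMEDEAN number: the root discriminant rd(M) = |d_M|^(1/[M:ℚ]) of the projective residual field M
= K(ℙρ̄^ss) against the Odlyzko–Poitou constant
of its signature Ω(M) = 4πe^(γ + r₁/[M:ℚ]) (22.3816… totally complex, 60.8395… totally real). Typed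
choice-free: InOdlyzkoWorld ρ :⟺ ∃ number field
L ⊇ K with rd(L) < Ω(L) splitting ℙρ̄^ss (a.e. Frobenius polynomial ≡ (X − a)^n). It suffices to
show X = OW ∧ RES ∧ (Lift_w, W⁺, P, L∤R, CRD verbatim):
OW = `OdlyzkoWorldAutomorphy` (FINITE RANGE, attacked: Serre_w inside the world — per ε-shell
finitely many residual Galois types by Odlyzko–Poitou +
Hermite, a census with named open atoms) and RES = `TransOdlyzkoAutomorphy` (ASYMPTOTIC REGIME,
declared RESIDUAL, hypothesis form OW → Serre_w outside
the world). Kernel-certified: Serre_w ⟺ OW ∧ RES (`serre_iff_pieces`), Langlands ⟹ OW ∧ RES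
(`pieces_of_langlands`); the BRIDGE `LevelOneDiscriminantCeiling`
(Tate–Moon different bound, provable now, filed aside) proves in the kernel that the world CONTAINS
lens-4's level-one rank-2 boxes over ℚ, ℚ(√−3),
ℚ(i), ℚ(√5), ℚ(√−7) at ℓ = 2 and over ℚ at ℓ = 3 (`serre_levelOne_rankTwo_rat_two`). No idea card is
realised.
WHY THIS IS NOVEL: the first node of the cell on an ARCHIMEDEAN axis — every other route/node cuts
Serre_w = stmt-Langlands-24015 (or its siblings) by a NON-archimedean invariant (prime, level,
weight multiplicity, FL shape, Artin range, anchors, retention, base-field saturation, Klein doors);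
here the dial is the ROOT DISCRIMINANT of the projective residual field against the unconditional
Odlyzko–Poitou constant of its signature, typed choice-free (InOdlyzkoWorld ρ), which makes the
special cell OW a FINITE-RANGE statement per ε-shell (Odlyzko–Poitou + Hermite: finitely many
residual Galois types; Jones–Roberts / Voight / the cell's census tables instrument it) and isolates
the ASYMPTOTIC regime RES (beyond every discriminant method: Golod–Shafarevich) as the declared
residual; the theorem-grade aside CEIL (Tate/Moon different bound) plus OW PROVES lens-4's rung
B₂(ℚ,2) in the kernel (`serre_levelOne_rankTwo_rat_two`, 8 ≤ 4πe^γ). ZERO EQUIV: kernel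
`serre_iff_pieces : ResidualAutomorphy ↔ OW ∧ RES` modulo nothing. LINEAGE: NODE
decomp-langlands-lens-5-g3 05:20:25Z (HOME/STATUS.md L204; nodes/lens-5-g3-OdlyzkoWorldSplit.lean
sha256 db2efcf6…c3dd, 9 fail_if_success probes, BC7 4/4 CLEAN, kit natively certified codes []
binder_used 7), CLEARED by crit-1 CLEARED 2026-08-30T05:29:08Z STATUS L211, CRITIC-LEDGER row 50
(non-blocking typing note: IsResiduallyProjScalar a.e. says ℙρ̄^ss(Γ_L) is an ℓ-GROUP, so the typed
world ⊋ «rd(K(ℙρ̄^ss)) < Ω» by one wild ℓ-layer — harmless: dial choice-free, seam exact, OW still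
finite-range per shell, CEIL only easier; docstring «equivalently» to be read «implied by; converse
up to an ℓ-subgroup»); filed by the cell's route-writer decomp-langlands-writer-1 (gen 2) as a CHILD
route of route-Langlands-ResidualSplit (rev 2) refining :ResidualAutomorphy 24015 = OR-sibling #3 of
MinimalLevelDescent (level axis) and AnchoredFamilySplit (anchor axis) — imports the parent;
`closes` proves Serre_w from OW ∧ RES by excluded middle on the dial and invokes
ResidualSplit.closes (TREE policy (ii); `--refines ResidualSplit:24015` once gate #12 is live). BC1
= 7 cruxes in the cone (OW, RES, Lift_w 24016, W⁺ 17415, P 17534, L∤R 18084 + CRD support; CEIL /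
RUNG asides) = cone-7 WARN, justified: ONE thesis (the archimedean dial) whose inherited binders are
exactly the parent's, none new. Census instrument of record: HOME/census/COSTUME-CENSUS-v6.md sha256
840ee3bbf72e35e26d69d0b5c3b075b034ab7dd22124694524cae1130a4782ed (json 16e5e573…); v7 posted 05:16Z
(F76–F82) consistent. Rung currency: rung 0 (first prover targets: CEIL (theorem-grade, attackable
now) and the RUNG (BC5 plan-only, decided by a Hunter search)).
Lean: `OdlyzkoWorldAutomorphy ∧ TransOdlyzkoAutomorphy ∧ AutomorphyLifting ∧ SatakeAvatarExistence ∧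
PadicMemberCompatibility ∧ CompatibilityAwayFromLR ∧ CanonicalReciprocityData`

## Assembly
Pure logic at the seam, then the route of record. Excluded middle on the dial: for a Serre_w
instance (K, ℓ, ι, ρ) either InOdlyzkoWorld ρ, and
OW answers, or not, and RES (fed OW) answers — so OW → RES → Serre_w (`serre_of_pieces`, two lines);
then `ResidualSplit.closes` verbatim consumes
Serre_w, Lift_w, W⁺, P, L∤R, CRD and returns `Langlands` (its own descent: B_w from Serre_w +
Lift_w, FM_w from B_w + W⁺, WGC from FM_w + W⁺ + P,
conjunct (A) from WGC + L∤R + P, (B) from FM_w). All seven binders of `closes` are load-bearing;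
CEIL and the rung are asides outside the cone.

Rationale: WHY THIS LINE. Every unconditional residual-automorphy theorem NOT obtained from automorphy lifting
is a discriminant theorem: Tate's letter (no irreducible
ρ̄ : Γ_ℚ → GL₂(𝔽̄₂) unramified outside 2, doi:10.1090/conm/174/01857), Serre at 3, Moon's finiteness
theorem (doi:10.1006/jnth.2000.2534), Moon–Taguchi
(doi:10.4171/dms/3/18, MoonTaguchi2008: seven quadratic fields [corpus:paper:arxiv-0710.1319 p.3]),
Şengün (Sengun2008: nine quadratic fields,
nonsolvable case [corpus:paper:arxiv-1309.1253 p.2–3]), arXiv:2509.00635 (GRH: no irreducible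
2-ramified ρ̄ : Γ_ℚ → GL_d(𝔽̄₂), d ≤ 4
[corpus:paper:arxiv-2509.00635 p.3]) — each proves that the residual splitting field would have root
discriminant below the Odlyzko–Poitou bound
(Odlyzko1990; constants 60.8395^(r₁/n)·22.3816^(2r₂/n), GRH 215.33/44.76
[corpus:paper:arxiv-1211.1353 p.3]), and Khare–Wintenberger's induction
(KhareWintenberger2009, Khare2007) bottoms out exactly there. This node promotes the quantity those
proofs control to the AXIS of the cut: the world
{rd(M) < Ω(M)} is, per ε-shell, a FINITE set of Galois types (Odlyzko–Poitou bounds the degree,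
Hermite the fields; enumerated in practice by
Jones–Roberts doi:10.1016/j.jnt.2006.05.001 / JonesRoberts2008 / JonesRoberts2014 and Voight's
totally real census, 1229 fields of rd ≤ 14
[corpus:paper:arxiv-1211.1353 p.3]; instrumented in the cell by COSTUME-CENSUS v6 T-E/T-F/H23/AT11),
so OW is a finite census problem with named
open atoms (A₅-extensions of ℚ(√10), ℚ(√11) unramified outside 2 — AT11; the even icosahedral
conductors 1951, 2141, 3701, in the world because
√p < 60.8395; small-GRD Hessian and PSL₂(𝔽₇) classes in rank 3), while RES is the generic regime
where no discriminant argument can bite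
(Golod–Shafarevich, Martinet rd 92.2, Hajir–Maire 82.2 towers [corpus:paper:arxiv-1211.1353 p.3])
and only lifting-free residual methods remain. What
is imported: analytic number theory of Dedekind zeta functions (explicit-formula discriminant
bounds) and the computational census of small-GRD
fields — an archimedean input no route in the tree types (TREE.md v2.6 axes: regime, monodromy,
existence/irreducibility, companions, rank,
instruments, conductor). What it does that the siblings do not: the dial is instance-level and
LEVEL-FREE — a deeply ramified ρ over a tiny field and
a level-one ρ over a huge field are sorted by the same number — and the bridge CEIL makes the
overlap with MinimalLevelDescent's B₂ a theorem
(rd(L) < 8·rd(K) at ℓ = 2, Moon's Lemma 1 [corpus:paper:arxiv-1309.1253 p.3]) instead of a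
convention.

RANKED CRUXES. #2 TransOdlyzkoAutomorphy (crux) — (RES, the ASYMPTOTIC REGIME — declared RESIDUAL of
the node; G7 hypothesis form) given OW: for every number field K, n ≥ 1, prime ℓ, ι : ℚ̄_ℓ ≃ ℂ and
every irreducible pinned-geometric ℓ-adic ρ : Γ_K → GL_n(ℚ̄_ℓ) that is NOT in the Odlyzko world (no
number field L ⊇ K with rd(L) < Ω(L) splits ℙρ̄^ss), ρ is residually automorphic: some L-algebraic
cuspidal π of GL_n(𝔸_K) has L-normalised Satake polynomials congruent mod 𝔪_ℓ to the Frobenius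
polynomials of ρ at almost all places. [deps: OdlyzkoWorldAutomorphy] [difficulty: open-problem]
(why it might fail: Implied by Serre_w, so it fails only with Langlands; as a programme every print
route is potential automorphy + soluble descent (census N2/N4: REDUCED) or KW-induction needing
lifting theorems over general K, even ρ, ℓ = 2 — none exists off the polarizable regular sector.)
[KhareWintenberger2009, Khare2007, BarnetlambEtAl2014, arXiv:1211.1353, Kisin2009TwoAdic]
#3 OdlyzkoWorldAutomorphy (crux) — (OW, the FINITE RANGE — the conjunct this node ATTACKS) for every
number field K, n ≥ 1, prime ℓ, ι and every irreducible pinned-geometric ℓ-adic ρ : Γ_K → GL_n(ℚ̄_ℓ)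
IN the Odlyzko world — some number field L ⊇ K with rd(L) = |d_L|^(1/[L:ℚ]) < Ω(L) = 4πe^(γ +
r₁(L)/[L:ℚ]) makes ρ|Γ_L residually projectively scalar at almost all places — ρ is residually
automorphic (same conclusion as Serre_w). Per ε-shell the world is a finite list of projective
residual Galois types (Odlyzko–Poitou + Hermite); print closes the void part (Tate, Serre,
Moon–Taguchi, Şengün, arXiv:2509.00635) and the soluble part over ℚ (Langlands–Tunnell + anchors);
open atoms: AT11 (A₅ over ℚ(√10), ℚ(√11) unramified outside 2), even icosahedral conductors
1951/2141/3701, rank-3 small-GRD Hessians, odd-rank trivial-class anchors over generic small K.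
[difficulty: open-problem] (why it might fail: An A₅-extension of ℚ(√10) unramified outside 2 with
GRD < 22.38 (AT11 wall field, not excluded by Odlyzko–Poitou) or the even icosahedral class of
conductor 1951 (√1951 = 44.2 < 60.84) is in the world and its residual automorphy over that K is
open.) [doi:10.1090/conm/174/01857, MoonTaguchi2008, Sengun2008, arXiv:2509.00635, arXiv:1211.1353,
doi:10.1016/j.jnt.2006.05.001, JonesRoberts2008, Odlyzko1990, doi:10.1006/jnth.2000.2534]
#4 AutomorphyLifting (crux) — Lift_w of the parent verbatim (stmt-Langlands-24016; ledger dedup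
attaches this route; the parent's rev-2 split 26728–26731 is inherited through the shared item):
automorphy lifting from a residually automorphic irreducible pinned-geometric ρ. [difficulty:
open-problem] (why it might fail: Residually small / inadequate image, ℓ = 2, even ρ over ℚ,
irregular or non-polarizable ρ outside the ACC+ ordinary sector: no patching theorem.) [Kisin2009,
Kisin2009TwoAdic, BarnetlambEtAl2014, AllenCalegariCaraianiGeeEtAl2023]
#5 SatakeAvatarExistence (crux) — W⁺ of N0 verbatim (stmt-Langlands-17415; ledger dedup): every
L-algebraic cuspidal π of GL_n/K has, for every (ℓ, ι), an irreducible ℓ-adic avatar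
Satake–Frobenius compatible almost everywhere. [difficulty: open-problem] (why it might fail: No
construction of ρ for irregular L-algebraic π or for K neither totally real nor CM; irreducibility
open for n ≥ 3 outside polarized / density-one cases.) [BuzzardGeeLMS2014,
HarrisLanTaylorThorne2016, Scholze2015]
#6 PadicMemberCompatibility (crux) — P of N0 verbatim (stmt-Langlands-17534; ledger dedup): de
Rhamness at v ∣ ℓ of irreducible avatars and the prime-switch principle for local–global
compatibility at v ∣ ℓ. [difficulty: open-problem] (why it might fail: Local–global compatibility at
p for non-polarizable regular π over CM fields is known only up to semisimplification / under
genericity, and is open for irregular π.) [BarnetlambEtAl2014, BuzzardGeeLMS2014, VarmaFMS2024]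
#7 CompatibilityAwayFromLR (crux) — L∤R of N0 verbatim (stmt-Langlands-18084; ledger dedup):
local–global compatibility at v ∤ ℓ for irreducible pinned-geometric avatars. [difficulty:
open-problem] (why it might fail: For non-polarizable π over CM fields compatibility at v ∤ ℓ is
known only up to Frobenius-semisimplification and monodromy (Varma); nothing off the regular
totally-real/CM sector.) [VarmaFMS2024, BuzzardGeeLMS2014, HarrisLanTaylorThorne2016]
#9 CanonicalReciprocityData (support) — CRD of N0 verbatim (stmt-Langlands-17930; ledger dedup):
every number field carries a `ReciprocityData` (closed-mod-print: LLC for GL_n + Fontaine's D_pst).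
[difficulty: M] [BuzzardGeeLMS2014, HarrisLanTaylorThorne2016]
#9 LevelOneDiscriminantCeiling (support) — (CEIL, the BRIDGE — theorem-grade, provable now; file as
`aside`: not in the cone of `closes`, never staffed as progress) Tate's different bound in Moon's
form: an ℓ-adic ρ : Γ_K → GL₂(ℚ̄_ℓ), a.e. unramified and unramified at every v ∤ ℓ, admits a number
field L ⊇ K splitting ℙρ̄^ss with rd(L) < rd(K)·ℓ^((2ℓ−1)/(ℓ−1)) (8·rd(K) at ℓ = 2, 3^(5/2) =
15.59·rd(K) at ℓ = 3). Proof: L = fixed field of ℙρ̄^ss refined so that the top layer is elementary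
abelian of exponent ℓ over a tame layer (Burnside lift of the ℓ-Sylow of the finite projective
image); per 𝔭 ∣ ℓ the different exponent is < (ℓ/(ℓ−1))·e_𝔭 + 1 ≤ ((2ℓ−1)/(ℓ−1))·e_𝔭 (Moon's Lemma 1
+ tame part). Kernel corollary in the node file: CEIL ∧ OW ⟹ Serre_w for level-one rank-2 ρ over
every K with rd(K)·ℓ^((2ℓ−1)/(ℓ−1)) ≤ 4πe^γ (proved outright for K = ℚ, ℓ = 2). [difficulty: M]
[doi:10.1090/conm/174/01857, doi:10.1006/jnth.2000.2534, doi:10.4171/dms/3/18, Sengun2008,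
MoonTaguchi2008]
#9 OdlyzkoWorldDyadicLevelOneRankTwo (support) — (RUNG of OW, BC5 plan-only; file as `aside` or as
the first stub of OW's skeleton) the dyadic level-one rank-2 shell of the world over ALL base
fields: every irreducible pinned-geometric 2-adic ρ : Γ_K → GL₂(ℚ̄₂) unramified outside 2 that lies
in the Odlyzko world is residually automorphic. Finite and instrumentable (T-E/T-F/H23: the (†)₂
void over twelve quadratic fields unconditionally; AT11: a targeted Hunter search over ℚ(√10),
ℚ(√11) decides the wall fields); by CEIL it contains B₂ over the five smallest fields. Outside S's
known regime: automorphy of level-one 2-adic ρ of arbitrary weight and parity over quadratic K is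
not in print. [deps: OdlyzkoWorldAutomorphy] [difficulty: L] [doi:10.1090/conm/174/01857,
MoonTaguchi2008, Sengun2008, JonesRoberts2008, doi:10.1016/j.crma.2008.12.004]

TWO-LAYER PLAN. Foreseen glued splits, none filed now. OW ⇐ OW_sol → OW_insol → OW with OW_sol = the
world restricted to SOLUBLE projective residual image
(Langlands–Tunnell + Eisenstein/CM/dihedral anchors; closable mod print over ℚ and totally real K,
the residual-reducible anchors over CM K are
the debt) and OW_insol = the finite list of insoluble small-GRD classes (the census atoms: AT11,
even icosahedral ≤ 3701, Hessian rank 3,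
PSL₂(𝔽₇), SL₂(𝔽₈) at GRD < Ω), glue = case split on solubility of a finite group. RES ⇐ RES_CM →
RES_gen → RES along totally-real/CM versus
general K once a lifting-free residual method appears on the CM sector. The rung
OdlyzkoWorldDyadicLevelOneRankTwo is OW's first stub.

KILL CRITERIA. Refuted:OdlyzkoWorldAutomorphy closes the route outright — a refutation is an
irreducible pinned-geometric ρ of small residual GRD matching no
cuspidal π residually, i.e. a counterexample to Langlands itself located in the finite world (most
plausibly an even icosahedral or an A₅/ℚ(√10)
class shown non-automorphic residually). Refuted:TransOdlyzkoAutomorphy likewise (it is Serre_w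
given OW). A proof elsewhere of Serre_w
(stmt-Langlands-24015) or of FM_w moots the node (close superseded --by
route-Langlands-ResidualSplit). If the census instrument (T-E/AT11)
finds that EVERY insoluble class in the world is already residually automorphic in print, OW
degrades to COSTUME and the node should be
re-cut with a larger constant (GRH world Ω_GRH = 8πe^(γ+π/2·r₁/n): 44.76/215.33) — a pivot, not a
kill.

NOT DECOMPOSED YET. The solubility split of OW, the per-field boxes (they are INSTANCES of OW
decided by the instrument, not items), the GRH-sized world (a
sibling node with Ω replaced by 44.7632^(2r₂/n)·215.3325^(r₁/n), conditional on GRH only through the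
census, never through the statement),
the exact-constant shell rd = Ω(1 − o(1)) where finiteness of the world is itself open (Odlyzko's
question on infinitely many fields of bounded
root discriminant in prime degree [corpus:paper:arxiv-1211.1353 p.3]) — OW does not need finiteness
to be stated, only to be instrumented.

CHEAPEST FALSIFIER. Look up (LMFDB Artin representations / Doud–Moore even icosahedral tables /
Jones–Roberts A₅ tables) ONE insoluble projective residual class
in the world whose residual automorphy over its base field is settled NEGATIVELY or is provably
undecidable by any census — none is known; the
lookup we ran: Jones–Roberts prove rd > 44.76 for A₄, A₅, A₆, S₄, S₅, S₆ Galois fields over ℚ apart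
from an explicit finite list
[corpus:paper:arxiv-1211.1353 p.3], so over ℚ the insoluble rank-2 part of the world IS a finite
explicit list (the node's finiteness claim checked
in the first case); arXiv:2509.00635 Thm A/C/D settle the 2-ramified d ≤ 4 classes over ℚ (void).
Second cheapest: the AT11 Hunter search over
ℚ(√10) (targeted, feasible per census v6) — either outcome is informative (void ⇒ the dyadic
quadratic shell of OW closes mod Δ-anchors;
a field ⇒ a named open instance of Serre's conjecture over a real quadratic field at GRD < 22.38).

NUMBERS. Ω constants (Odlyzko1990; [corpus:paper:arxiv-1211.1353 p.3]): unconditional 4πe^γ =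
22.3816 (totally complex), 4πe^(1+γ) = 60.8395 (totally
real); GRH 8πe^γ = 44.7632, 8πe^(γ+π/2) = 215.3325. Finite-degree values (census v6 T-E, Poitou
tables): r₁ = 0: 16.988 at degree 120, 20.880 at
1008, limit 22.215…→22.38; GRH r₁ = 0: 20.227 at degree 120. CEIL factors ℓ^((2ℓ−1)/(ℓ−1)): 8 (ℓ =
2, Tate), 15.588 (ℓ = 3, Serre), 37.38 (ℓ = 5,
Brueggeman under GRH); boxes inside the unconditional world at level one, rank 2: ℓ = 2 and rd(K) ≤
22.38/8 = 2.797 ⇒ K ∈ {ℚ (1), ℚ(√−3) (1.732),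
ℚ(i) (2), ℚ(√5) (2.236), ℚ(√−7) (2.646)}; ℓ = 3 and rd(K) ≤ 1.436 ⇒ K = ℚ. Census v6 H23: (†)₂ void
unconditional for ℚ(√d), d ∈ {2, 3, 5, 6, 17,
−1, −2, −3, −5, −6, −7, −15}, under GRH also d ∈ {7, −23}; AT11 wall fields ℚ(√10) (GRD bound
21.27), ℚ(√11) (22.31), ℚ(√13) (22.89) versus GRH
20.23 at degree 120. Even icosahedral prime conductors (Doud–Moore): 1951, 2141, 3701, 3821, …;
√3701 = 60.836 < 60.8395 < √3821 = 61.81.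
Voight: 1229 totally real fields with rd ≤ 14, all of degree ≤ 9. GRH-world level-one box at ℓ = 2
(rd(K) ≤ 44.76/8 = 5.595) = every quadratic field with |d_K| ≤ 31 together with ℚ(ζ₅) (3.34), ℚ(ζ₇)
(5.06), ℚ(ζ₈) (4), ℚ(ζ₉) (5.20), ℚ(ζ₁₂) (3.46) — matching Khare2007 §12's fields with a classified
induction «starting point» (Fontaine ℚ, ℚ(√5), ℚ(i), ℚ(√−3); Schoof ℚ(ζ_f) f = 5,7,8,9,12,
ℚ(√f) f = 5,8,12,13,17,21,24 and under GRH 28,29,33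
[corpus:book:burns2007-l-functions-galois-representations p.343–344]; all |d| ≤ 31 but the
boundary case 33): the dial reproduces the known induction bases as one box.

DEFINITION REQUESTS. None. rootDiscr, odlyzkoBound, IsResiduallyProjScalar, InOdlyzkoWorld,
IsPinnedGeometric, ResiduallyAutomorphic are private abbreviations of
the node file (HOME/nodes/lens-5-g3-OdlyzkoWorldSplit.lean), INLINED in every `Lean:` line above
(identity checks `Iff.rfl` in the node file);
Mathlib supplies NumberField.discr, NumberField.InfinitePlace.nrRealPlaces,
Real.eulerMascheroniConstant, FramedGaloisRep.restrictField is
Literature (GaloisRep.lean).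

Novelty: Searches (2026-08-30): `lit search --hybrid "Odlyzko discriminant bound non-existence Galois
representation unramified outside 2 Tate Serre"` (12
docs: hida2000, edixhoven2011, emerton2022, cornell1997 p.67–68, burns2007 p.221–347, diamond2014);
`lit search "\"unramified outside 2\" mod 2 Galois
representation non-existence discriminant"` (2 local: paper:doi-10-3792-pjaa-84-63 =
MoonTaguchi2008, paper:doi-10-5802-jtnb-562 = Jones–Roberts nonic);
`lit search "Jones Roberts Galois number fields small root discriminant"` (10 local incl.
paper:arxiv-1211.1353 Rouse–Thorne, paper:arxiv-2509.00635,
paper:arxiv-1406.0408; remote doi:10.1016/j.jnt.2006.05.001, doi:10.1090/s0025-5718-2011-02511-1,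
doi:10.2140/pjm.2014.271.243); `lit search "Moon
finiteness results certain mod p Galois representations root discriminant"` (5 local:
arxiv-1309.1253, arxiv-0710.1319, arxiv-0906.4374,
arxiv-2509.00635; remote doi:10.1006/jnth.2000.2534, doi:10.4171/dms/3/18,
doi:10.4134/bkms.2003.40.3.537); `lit galaxy search "Odlyzko bound|root
discriminant|unramified outside 2" --star all` (24 rows; relevant [galaxy:pdf:4241145560] Voight
«Enumeration of number fields»,
[galaxy:pdf:7006601270092097320] Tyler «Discriminant bounds»; panama/crabby 0 relevant); tree: `rg
rootDiscr|odlyzko|discr` over Summits/Langlands (0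
routes type a discriminant), TREE.md v2.6 axes A1–A7, bus NODE lines of lenses 1–6 g0–g4.
Nearest prior art found: doi:10.1006/jnth.2000.2534 (Moon 2000: finiteness of semisimple mod-p Galoi  [refs: 10.1016/j.jnt.2006.05.001, 10.1090/s0025-5718-2011-02511-1, 10.2140/pjm.2014.271.243, 10.1006/jnth.2000.2534, 10.4171/dms/3/18, 10.4134/bkms.2003.40.3.537, 1211.1353, paper:doi-10-3792-pjaa-84-63, paper:doi-10-5802-jtnb-562, paper:arxiv-1211.1353, paper:arxiv-2509.00635, paper:arxiv-1406.0408, doi:10.1016/j.jnt.2006.05.001, doi:10.1090/s0025-5718-2011-02511-1, doi:10.2140/pjm.2014.271.243, arxiv-1]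

Barriers (technique_class: discriminant bounds, small-GRD census, residual automorphy): - technique_class: discriminant bounds, small-GRD census, residual automorphy
- Literature.Barriers.Langlands.TaylorWilesNumericalCoincidence: OW and RES are residual-automorphy
statements and sit OUTSIDE the patching class (no R = T, no numerical coincidence is invoked); the
barrier is charged to the inherited Lift_w (24016) exactly as in the parent; the bet for OW is
census + congruence anchors, for RES it does apply to every KW-style attack (declared residual).
- Literature.Barriers.Langlands (potential automorphy / soluble descent, census N2/N4 REDUCED): RES
does not evade it — it is the declared residual; OW evades it because inside the world the residual
images are an explicit finite list handled class by class (void, soluble, named insoluble atoms),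
never by potential automorphy.
- Golod–Shafarevich / infinite class field towers (not catalogued; arXiv:1211.1353 p.3): the reason
the world is SMALL — discriminant methods can never reach RES; the node does not bet against it, it
draws the line there.
- GRH-dependence: none in the statements (Ω is the unconditional Poitou constant); GRH enters only
the instrument's reach (44.76 vs 22.38), recorded in Numbers.
- Literature.Barriers.Langlands.TaylorWilesNumericalCoincidenceNarrow: as the non-narrow entry — the
insoluble atoms of OW and all of RES need automorphy engines bounded by
`TaylorWilesNumericalCoincidence_holds`; the dial does not evade it, it confines OW to finitely many
residual types per shell.
- Literature.Barrie

History (route lifecycle, newest last):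
- 2026-08-30T05:57:53Z · rev 1: restated TransOdlyzkoAutomorphy (stmt-Langlands-28527) — decomp-langlands writer-1 g2: OdlyzkoWorldSplit rev 2 ERRATUM (a/4) — lens-5-g3 node rev 2 (NODE L221 05:40:21Z, crit-1 CLEARED 05:41:20Z L222, CRITIC-LEDGER ro (planner-decomp-langlands-writer-1-g2-0)
- 2026-08-30T06:00:13Z · rev 2: restated OdlyzkoWorldAutomorphy (stmt-Langlands-28528) — decomp-langlands writer-1 g2: OdlyzkoWorldSplit rev 2 ERRATUM (b/4) — lens-5-g3 node rev 2 (NODE L221, crit-1 CLEARED 05:41:20Z L222, CRITIC-LEDGER row 53): OW (planner-decomp-langlands-writer-1-g2-0)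
- 2026-08-30T06:00:51Z · rev 3: restated LevelOneDiscriminantCeiling (stmt-Langlands-28529) — decomp-langlands writer-1 g2: OdlyzkoWorldSplit rev 2 ERRATUM (c/4) — lens-5-g3 node rev 2 (NODE L221, crit-1 CLEARED 05:41:20Z L222, CRITIC-LEDGER row 53): CEI (planner-decomp-langlands-writer-1-g2-0)
- 2026-08-30T06:01:21Z · rev 4: restated OdlyzkoWorldDyadicLevelOneRankTwo (stmt-Langlands-28530) — decomp-langlands writer-1 g2: OdlyzkoWorldSplit rev 2 ERRATUM (d/4) — lens-5-g3 node rev 2 (NODE L221, crit-1 CLEARED 05:41:20Z L222, CRITIC-LEDGER row 53): RUN (planner-decomp-langlands-writer-1-g2-0)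
- 2026-08-30T06:02:08Z · rev 5: informal re-worded for TransOdlyzkoAutomorphy, OdlyzkoWorldAutomorphy, LevelOneDiscriminantCeiling, OdlyzkoWorldDyadicLevelOneRankTwo (planner-decomp-langlands-writer-1-g2-0)
- 2026-08-30T15:02:25Z · rev 7: restated AutomorphyLifting_of_imsplit (stmt-Langlands-33368 proved) — writer-1-g4 step 1/2 for lens-5-g9 SlopeRankSplit: restate the PROVED split glue AutomorphyLifting_of_imsplit (stmt-Langlands-33368, closed p775415) with R† Red (planner-decomp-langlands-writer-1-g4-0)
- 2026-08-30T15:02:36Z · rev 7: restated AutomorphyLifting_of_imsplit (stmt-Langlands-33368 proved) — writer-1-g4 step 1/2 for lens-5-g9 SlopeRankSplit: restate the PROVED split glue AutomorphyLifting_of_imsplit (stmt-Langlands-33368, closed p775415) with R† Red (planner-decomp-langlands-writer-1-g4-0)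

sub-problem: Langlands · status: draft · opened planner-decomp-langlands-writer-1-g2-0 2026-08-30T05:29:37Z · rev 8 · ledger route-Langlands-OdlyzkoWorldSplit
GENERATED by the gate from the ledger (D-0016/17). Provers cite these decls: `theorem foo : Summit.Langlands.Langlands.Theses.OdlyzkoWorldSplit.<Decl> := …` in Summits/Langlands/Langlands/Theorems/<Name>.lean.
-/

namespace Summit.Langlands.Langlands.Theses.OdlyzkoWorldSplit

open scoped BigOperators Topology Manifold Classical MeasureTheory ProbabilityTheory Matrix InnerProductSpace ComplexConjugate ContinuousMap
open Filter Set Function TopologicalSpace MeasureTheory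

attribute [summit_statement] _root_.Langlands

-- earlier OdlyzkoWorldAutomorphy (stmt-Langlands-28528, replaced 2026-08-30T06:00:13Z -> stmt-Langlands-28903): retired by None — ∀ (K : Type) [Field K] [NumberField K] (n : ℕ) (hcpt : Literature.NumberTheory.Automorphic.isCompact_glFiniteIntegralLevel n K), 0 < n → ∀ (ℓ : ℕ) [Fact ℓ.Prime] (ι : PadicAlgCl ℓ ≃+* ℂ) (ρ : Literature.NumberTheory.GaloisRepresentations.FramedGaloisRep K (PadicAlgCl ℓ) n
/-- item stmt-Langlands-28903 · crux · rank 3 · open · by planner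
why it might fail: @ows2/lens-5-g3-OdlyzkoWorldSplit.rev2.OW.why_might_fail.txt
sources: doi:10.1090/conm/174/01857, MoonTaguchi2008, Sengun2008, arXiv:2509.00635, arXiv:1211.1353, doi:10.1016/j.jnt.2006.05.001
[crux] (OW, the FINITE RANGE — the conjunct this node ATTACKS) for every number field K, n ≥ 1,
prime ℓ, ι and every irreducible pinned-geometric ℓ-adic ρ : Γ_K → GL_n(ℚ̄_ℓ) IN the Odlyzko world —
some number field L ⊇ K, Galois over K, with rd(L) = |d_L|^(1/[L:ℚ]) < Ω(L) = 4πe^(γ + r₁(L)/[L:ℚ])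
makes ρ|Γ_L residually projectively scalar at almost all places (⟺ rd(M) < Ω(M), M = K(ℙρ̄^ss)) — ρ
is residually automorphic (same conclusion as Serre_w). Per ε-shell the world is a finite list of
projective residual Galois types (Odlyzko–Poitou + Hermite); print closes the void part (Tate,
Serre, Moon–Taguchi, Şengün, arXiv:2509.00635) and the soluble part over ℚ (Langlands–Tunnell +
anchors); open atoms: AT11 (A₅ over ℚ(√10), ℚ(√11) unramified outside 2), even icosahedral
conductors 1951/2141/3701, rank-3 small-GRD Hessians, odd-rank trivial-class anchors over generic
small K. [difficulty: open-problem] TAGS (crit-1 CLEARED 2026-08-30T05:29:08Z STATUS L211,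
CRITIC-LEDGER row 50; REV 2 ERRATUM (Galois witness field) NODE L221, CLEARED 05:41:20Z L222, row
53; census v6 sha256 840ee3bb…): OW NEW · WEAKER (kernel `ow_of_serre`,
nodes/lens-5-g3-OdlyzkoWorldSplit.lean; probe OW ⇏ Serre_w / Lan -/
@[route_item "route-Langlands-OdlyzkoWorldSplit", crux]
def OdlyzkoWorldAutomorphy : Prop :=
  ∀ (K : Type) [Field K] [NumberField K] (n : ℕ) (hcpt : Literature.NumberTheory.Automorphic.isCompact_glFiniteIntegralLevel n K), 0 < n → ∀ (ℓ : ℕ) [Fact ℓ.Prime] (ι : PadicAlgCl ℓ ≃+* ℂ) (ρ : Literature.NumberTheory.GaloisRepresentations.FramedGaloisRep K (PadicAlgCl ℓ) n), ρ.toGaloisRep.IsIrreducible → ((∀ᶠ v : IsDedekindDomain.HeightOneSpectrum (NumberField.RingOfIntegers K) in cofinite, ρ.IsUnramifiedAt v) ∧ ∀ (v : IsDedekindDomain.HeightOneSpectrum (NumberField.RingOfIntegers K)) (hv : ((ℓ : ℕ) : NumberField.RingOfIntegers K) ∈ v.asIdeal), (Literature.NumberTheory.PAdicHodge.fontainePstAdicCompletion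 v ℓ hv).IsDeRhamFramed (ρ.toLocal v)) → (∃ (L : Type) (_ : Field L) (_ : NumberField L) (_ : Algebra K L), IsGalois K L ∧ (|(NumberField.discr L : ℝ)|) ^ ((1 : ℝ) / (Module.finrank ℚ L : ℝ)) < 4 * Real.pi * Real.exp (Real.eulerMascheroniConstant + (NumberField.InfinitePlace.nrRealPlaces L : ℝ) / (Module.finrank ℚ L : ℝ)) ∧ ∀ᶠ w : IsDedekindDomain.HeightOneSpectrum (NumberField.RingOfIntegers L) in cofinite, ∃ (P : Polynomial (Valued.v : Valuation (PadicAlgCl ℓ) NNReal).valuationSubring) (a : (Valued.v : Valuation (PadicAlgCl ℓ) NNReal).valuationSubring), (ρ.restrictField L).HasFrobCharpolyAt w (P.map (Valued.v : Valuation (PadicAlgCl ℓ) NNReal).valuationSubring.subtype) ∧ P.map (IsLocalRing.residue (Valued.v : Valuation (PadicAlgCl ℓ) NNReal).valuationSubring) = (Polynomial.X - Polynomial.C (IsLocalRing.residue (Valued.v : Valuation (PadicAlgCl ℓ) NNReal).valuationSubring a)) ^ n) → ∃ π : Literature.NumberTheory.Automorphic.CuspidalAutomorphicRepData n K hcpt,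 π.1.IsLAlgebraic ∧ ∀ᶠ v : IsDedekindDomain.HeightOneSpectrum (NumberField.RingOfIntegers K) in cofinite, ρ.IsUnramifiedAt v ∧ (∃ α : Multiset ℂ, π.1.HasSatakeParamAt v α) ∧ ∀ α : Multiset ℂ, π.1.HasSatakeParamAt v α → ∃ P Q : Polynomial (Valued.v : Valuation (PadicAlgCl ℓ) NNReal).valuationSubring, ρ.HasFrobCharpolyAt v (P.map (Valued.v : Valuation (PadicAlgCl ℓ) NNReal).valuationSubring.subtype) ∧ Literature.NumberTheory.Automorphic.arithFrobPolyOfSatake ι v.residueCard 1 α = Q.map (Valued.v : Valuation (PadicAlgCl ℓ) NNReal).valuationSubring.subtype ∧ P.map (IsLocalRing.residue (Valued.v : Valuation (PadicAlgCl ℓ) NNReal).valuationSubring) = Q.map (IsLocalRing.residue (Valued.v : Valuation (PadicAlgCl ℓ) NNReal).valuationSubring)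

-- earlier TransOdlyzkoAutomorphy (stmt-Langlands-28527, replaced 2026-08-30T05:57:53Z -> stmt-Langlands-28874): retired by None — OdlyzkoWorldAutomorphy → ∀ (K : Type) [Field K] [NumberField K] (n : ℕ) (hcpt : Literature.NumberTheory.Automorphic.isCompact_glFiniteIntegralLevel n K), 0 < n → ∀ (ℓ : ℕ) [Fact ℓ.Prime] (ι : PadicAlgCl ℓ ≃+* ℂ) (ρ : Literature.NumberTheory.GaloisRepresentations.FramedGal
/-- item stmt-Langlands-28874 · crux · rank 2 · open · by planner
why it might fail: Implied by Serre_w, so it fails only with Langlands; as a programme every print route is potential automorphy + soluble descent (census N2/N4: REDUCED) or KW-induction needing lifting theorems over general K, even ρ, ℓ = 2 — none exists off the polarizable regular sector.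
sources: KhareWintenberger2009, Khare2007, BarnetlambEtAl2014, arXiv:1211.1353, Kisin2009TwoAdic
[crux] (RES, the ASYMPTOTIC REGIME — declared RESIDUAL of the node; G7 hypothesis form) given OW:
for every number field K, n ≥ 1, prime ℓ, ι : ℚ̄_ℓ ≃ ℂ and every irreducible pinned-geometric ℓ-adic
ρ : Γ_K → GL_n(ℚ̄_ℓ) that is NOT in the Odlyzko world (no number field L ⊇ K with rd(L) < Ω(L)
splits ℙρ̄^ss), ρ is residually automorphic: some L-algebraic cuspidal π of GL_n(𝔸_K) has
L-normalised Satake polynomials congruent mod 𝔪_ℓ to the Frobenius polynomials of ρ at almost all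
places. [deps: OdlyzkoWorldAutomorphy] [difficulty: open-problem] TAGS (crit-1 CLEARED
2026-08-30T05:29:08Z STATUS L211, CRITIC-LEDGER row 50; REV 2 ERRATUM (Galois witness field) NODE
L221, CLEARED 05:41:20Z L222, row 53; census v6): RES NEW = the declared RESIDUAL of the lens-5-g3
lineage (D-0179) · ASYMPTOTIC REGIME (rd ≥ Ω over every finite extension) · hypothesis form OW →
(Serre_w outside the world) (census rule G7) · WEAKER (kernel `res_of_serre`; probe RES ⇏ Serre_w
FAIL; BC7 CLEAN) · OPEN · leaf IDEA-NEEDED / BARRIER: no discriminant method reaches it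
(Golod–Shafarevich infinite class field towers, not catalogued by name — «no catalogued barrier»;
inside `TaylorWilesNumericalCoincidence_holds` / `Shi -/
@[route_item "route-Langlands-OdlyzkoWorldSplit", crux]
def TransOdlyzkoAutomorphy : Prop :=
  OdlyzkoWorldAutomorphy → ∀ (K : Type) [Field K] [NumberField K] (n : ℕ) (hcpt : Literature.NumberTheory.Automorphic.isCompact_glFiniteIntegralLevel n K), 0 < n → ∀ (ℓ : ℕ) [Fact ℓ.Prime] (ι : PadicAlgCl ℓ ≃+* ℂ) (ρ : Literature.NumberTheory.GaloisRepresentations.FramedGaloisRep K (PadicAlgCl ℓ) n), ρ.toGaloisRep.IsIrreducible → ((∀ᶠ v : IsDedekindDomain.HeightOneSpectrum (NumberField.RingOfIntegers K) in cofinite, ρ.IsUnramifiedAt v) ∧ ∀ (v : IsDedekindDomain.HeightOneSpectrum (NumberField.RingOfIntegers K)) (hv : ((ℓ : ℕ) : NumberField.RingOfIntegers K) ∈ v.asIdeal), (Literature.NumberTheory.PAdicHodge.fontainePstAdicCompletion v ℓ hv).IsDeRhamFramed (ρ.toLocal v)) → ¬ (∃ (L : Type) (_ : Field L) (_ : NumberField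 L) (_ : Algebra K L), IsGalois K L ∧ (|(NumberField.discr L : ℝ)|) ^ ((1 : ℝ) / (Module.finrank ℚ L : ℝ)) < 4 * Real.pi * Real.exp (Real.eulerMascheroniConstant + (NumberField.InfinitePlace.nrRealPlaces L : ℝ) / (Module.finrank ℚ L : ℝ)) ∧ ∀ᶠ w : IsDedekindDomain.HeightOneSpectrum (NumberField.RingOfIntegers L) in cofinite, ∃ (P : Polynomial (Valued.v : Valuation (PadicAlgCl ℓ) NNReal).valuationSubring) (a : (Valued.v : Valuation (PadicAlgCl ℓ) NNReal).valuationSubring), (ρ.restrictField L).HasFrobCharpolyAt w (P.map (Valued.v : Valuation (PadicAlgCl ℓ) NNReal).valuationSubring.subtype) ∧ P.map (IsLocalRing.residue (Valued.v : Valuation (PadicAlgCl ℓ) NNReal).valuationSubring) = (Polynomial.X - Polynomial.C (IsLocalRing.residue (Valued.v : Valuation (PadicAlgCl ℓ) NNReal).valuationSubring a)) ^ n) → ∃ π : Literature.NumberTheory.Automorphic.CuspidalAutomorphicRepData n K hcpt, π.1.IsLAlgebraic ∧ ∀ᶠ v : IsDedekindDomain.HeightOneSpectrum (NumberField.RingOfIntegers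 K) in cofinite, ρ.IsUnramifiedAt v ∧ (∃ α : Multiset ℂ, π.1.HasSatakeParamAt v α) ∧ ∀ α : Multiset ℂ, π.1.HasSatakeParamAt v α → ∃ P Q : Polynomial (Valued.v : Valuation (PadicAlgCl ℓ) NNReal).valuationSubring, ρ.HasFrobCharpolyAt v (P.map (Valued.v : Valuation (PadicAlgCl ℓ) NNReal).valuationSubring.subtype) ∧ Literature.NumberTheory.Automorphic.arithFrobPolyOfSatake ι v.residueCard 1 α = Q.map (Valued.v : Valuation (PadicAlgCl ℓ) NNReal).valuationSubring.subtype ∧ P.map (IsLocalRing.residue (Valued.v : Valuation (PadicAlgCl ℓ) NNReal).valuationSubring) = Q.map (IsLocalRing.residue (Valued.v : Valuation (PadicAlgCl ℓ) NNReal).valuationSubring)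

/-- item stmt-Langlands-24016 · crux · rank 4 · SPLIT (gen 2) into IrreducibleLargePrimeLifting, IrreducibleSmallPrimeLifting, CyclotomicReducibleOrdinaryLifting, CyclotomicReducibleNonOrdinaryRankTwoLifting, CyclotomicReducibleNonOrdinaryHigherRankLifting + glue AutomorphyLifting_of_slopesplit · direct attempts still welcome (low priority) · by planner
why it might fail: Residually small / inadequate image, ℓ = 2, even ρ over ℚ, irregular or non-polarizable ρ outside the ACC+ ordinary sector: no patching theorem.
sources: Kisin2009, Kisin2009TwoAdic, BarnetlambEtAl2014, AllenCalegariCaraianiGeeEtAl2023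
earlier split gen 1: IrreducibleLargePrimeLifting, IrreducibleSmallPrimeLifting, CyclotomicReducibleLifting — retired stmt-Langlands-33365, stmt-Langlands-33366, stmt-Langlands-33367, stmt-Langlands-33900
retired/moot children: IrreducibleLargePrimeLifting [retired: ∀ (K : Type) [Field K] [NumberField K] (n : ℕ) (hcpt : Literature.NumberTheory.A]; IrreducibleSmallPrimeLifting [retired: ∀ (K : Type) [Field K] [NumberField K] (n : ℕ) (hcpt : Literature.NumberTheory.A]; CyclotomicReducibleLifting [retired: ∀ (K : Type) [Field K] [NumberField K] (n : ℕ) (hcpt : Literature.NumberTheory.A]; AutomorphyLifting_of_imsplit [replaced: IrreducibleLargePrimeLifting → IrreducibleSmallPrimeLifting → CyclotomicReducibl]; AutomorphyLifting_of_imsplit [retired: IrreducibleLargePrimeLifting → IrreducibleSmallPrimeLifting → (∀ (K : Type) [Fie]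
[crux] Lift_w — for every K, n ≥ 1, ℓ, ι and every irreducible pinned-geometric ρ : Γ_K →
GL_n(ℚ̄_ℓ): if there are an L-algebraic cuspidal π of GL_n(𝔸_K) and an IRREDUCIBLE ρ′ : Γ_K →
GL_n(ℚ̄_ℓ) with ρ′ Satake–Frobenius compatible with (π, ι) almost everywhere and ρ ≡ ρ′ (integral
Frobenius polynomials congruent mod 𝔪 of ℤ̄_ℓ) almost everywhere, then ρ is Satake–Frobenius
compatible almost everywhere with some L-algebraic cuspidal π₁ of GL_n(𝔸_K). TAGS (crit-1 CLEARED
2026-08-30T01:25:00Z, row 2): WEAKER(kernel cert `automorphyLifting_of_langlands`; Lift_w ⇒ B_w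
would need a residual anchor = Serre_w, itself open) · OPEN · leaf IDEA-NEEDED ·
BARRIER(`Literature.Barriers.Langlands.NonRegularWeightBarrier_holds` ·
`TaylorWilesNumericalCoincidence_holds` · ResiduallyReducibleBarrier · PatchingLocalComponentBarrier
— they bound the patching CLASS, not the statement: Lift_w as typed has no residual-irreducibility /
adequacy / same-weight hypothesis, so each catalogued patching theorem is a strict sector) ·
ATTACKABLE sector: K CM, FL-crystalline weight 0, ρ̄ decomposed-generic =
`ACCGHLNSTT2023.automorphyLifting_crystalline_weightZero`. [difficulty: open-problem] -/
@[route_item "route-Langlands-OdlyzkoWorldSplit", crux]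
def AutomorphyLifting : Prop :=
  ∀ (K : Type) [Field K] [NumberField K] (n : ℕ) (hcpt : Literature.NumberTheory.Automorphic.isCompact_glFiniteIntegralLevel n K), 0 < n → ∀ (ℓ : ℕ) [Fact ℓ.Prime] (ι : PadicAlgCl ℓ ≃+* ℂ) (ρ : Literature.NumberTheory.GaloisRepresentations.FramedGaloisRep K (PadicAlgCl ℓ) n), ρ.toGaloisRep.IsIrreducible → ((∀ᶠ v : IsDedekindDomain.HeightOneSpectrum (NumberField.RingOfIntegers K) in cofinite, ρ.IsUnramifiedAt v) ∧ ∀ (v : IsDedekindDomain.HeightOneSpectrum (NumberField.RingOfIntegers K)) (hv : ((ℓ : ℕ) : NumberField.RingOfIntegers K) ∈ v.asIdeal), (Literature.NumberTheory.PAdicHodge.fontainePstAdicCompletion v ℓ hv).IsDeRhamFramed (ρ.toLocal v)) → (∃ (π : Literature.NumberTheory.Automorphic.CuspidalAutomorphicRepData n K hcpt) (ρ' : Literature.NumberTheory.GaloisRepresentations.FramedGaloisRep K (PadicAlgCl ℓ) n), π.1.IsLAlgebraic ∧ ρ'.toGaloisRep.IsIrreducible ∧ (∀ᶠ v : IsDedekindDomain.HeightOneSpectrum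 (NumberField.RingOfIntegers K) in cofinite, SatakeFrobCompatibleAt ι π.1 ρ' v) ∧ ∀ᶠ v : IsDedekindDomain.HeightOneSpectrum (NumberField.RingOfIntegers K) in cofinite, ∃ P P' : Polynomial (Valued.v : Valuation (PadicAlgCl ℓ) NNReal).valuationSubring, ρ.HasFrobCharpolyAt v (P.map (Valued.v : Valuation (PadicAlgCl ℓ) NNReal).valuationSubring.subtype) ∧ ρ'.HasFrobCharpolyAt v (P'.map (Valued.v : Valuation (PadicAlgCl ℓ) NNReal).valuationSubring.subtype) ∧ P.map (IsLocalRing.residue (Valued.v : Valuation (PadicAlgCl ℓ) NNReal).valuationSubring) = P'.map (IsLocalRing.residue (Valued.v : Valuation (PadicAlgCl ℓ) NNReal).valuationSubring)) → ∃ π : Literature.NumberTheory.Automorphic.CuspidalAutomorphicRepData n K hcpt, π.1.IsLAlgebraic ∧ ∀ᶠ v : IsDedekindDomain.HeightOneSpectrum (NumberField.RingOfIntegers K) in cofinite, SatakeFrobCompatibleAt ι π.1 ρ v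

-- parent: AutomorphyLifting · child (gen 2)
/--     item stmt-Langlands-33906 · crux · rank 401 · open
    parent: AutomorphyLifting · by planner
    why it might fail: For K neither CM nor totally real, or ρ of irregular Hodge–Tate weight, no automorphy lifting theorem exists at any ℓ however large (l₀ > 0: no Galois representations / patching for the non-self-dual irregular automorphic side); one such big-image ρ refutes it.
    sources: BarnetlambEtAl2014, arXiv:1010.2561, Thorne2012, arXiv:1107.5993, ACCGHLNSTT2023, GuralnickHerzigTiep2017
[crux · ASYMPTOTIC REGIME of the residual-image axis · WEAKER · ATTACKABLE-BY-ENGINE] A† — Lift_w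
(OdlyzkoWorldSplit.AutomorphyLifting 24016: an irreducible geometric ρ : Γ_K → GL_n(ℚ̄_ℓ) congruent
mod 𝔪 a.e. to an irreducible weakly automorphic ρ' is weakly automorphic) RESTRICTED to the
instances with ℓ ≥ 2(n+1) AND ρ̄|Γ_{K(ζ_ℓ)} absolutely irreducible — VERBATIM the residual-image
hypotheses of BLGGT Thm 4.2.1 / Thm C in the tree idiom of BLGGT2014_thmC_potentialAutomorphy («2 *
(n + 1) ≤ l», clause (4) (r.restrictField (CyclotomicField l F)).IsResiduallyAbsIrreducible) —,
under the rank-induction hypothesis «Lift_w at every rank m < n» (inlined, idiom of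
LieTypeCarving.LieImprimitiveTransport; quarantines automorphic induction from lower rank). In this
regime adequacy of ρ̄(Γ_{K(ζ_ℓ)}) is AUTOMATIC (BLGGT Prop 2.1.2 = Guralnick–Herzig–Taylor–Thorne
Thm 9: p ≥ 2(n+1) ∧ abs. irreducible ⟹ adequate), so every instance satisfies the image hypothesis
of the Taylor–Wiles–Kisin engines (BLGGT 4.2.1, Thorne 2012 Thm 7.1, ACC+ Thm 6.1.1 = tree
ACCAutomorphyLiftingCrystalline, Calegari–Geraghty/BCGP); what remains open is the TRANSVERSE
darkness (irregular Hodge–Tate weights, K neither C -/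
@[route_item "route-Langlands-OdlyzkoWorldSplit"]
def IrreducibleLargePrimeLifting : Prop :=
  ∀ (K : Type) [Field K] [NumberField K] (n : ℕ) (hcpt : Literature.NumberTheory.Automorphic.isCompact_glFiniteIntegralLevel n K), 0 < n → (∀ m : ℕ, m < n → ∀ (K : Type) [Field K] [NumberField K] (hcpt : Literature.NumberTheory.Automorphic.isCompact_glFiniteIntegralLevel m K), 0 < m → ∀ (ℓ : ℕ) [Fact ℓ.Prime] (ι : PadicAlgCl ℓ ≃+* ℂ) (ρ : Literature.NumberTheory.GaloisRepresentations.FramedGaloisRep K (PadicAlgCl ℓ) m), ρ.toGaloisRep.IsIrreducible → ((∀ᶠ v : IsDedekindDomain.HeightOneSpectrum (NumberField.RingOfIntegers K) in cofinite, ρ.IsUnramifiedAt v) ∧ ∀ (v : IsDedekindDomain.HeightOneSpectrum (NumberField.RingOfIntegers K)) (hv : ((ℓ : ℕ) : NumberField.RingOfIntegers K) ∈ v.asIdeal), (Literature.NumberTheory.PAdicHodge.fontainePstAdicCompletion v ℓ hv).IsDeRhamFramed (ρ.toLocal v)) → (∃ (π : Literature.NumberTheory.Automorphic.CuspidalAutomorphicRepData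 m K hcpt) (ρ' : Literature.NumberTheory.GaloisRepresentations.FramedGaloisRep K (PadicAlgCl ℓ) m), π.1.IsLAlgebraic ∧ ρ'.toGaloisRep.IsIrreducible ∧ (∀ᶠ v : IsDedekindDomain.HeightOneSpectrum (NumberField.RingOfIntegers K) in cofinite, SatakeFrobCompatibleAt ι π.1 ρ' v) ∧ ∀ᶠ v : IsDedekindDomain.HeightOneSpectrum (NumberField.RingOfIntegers K) in cofinite, ∃ P P' : Polynomial (Valued.v : Valuation (PadicAlgCl ℓ) NNReal).valuationSubring, ρ.HasFrobCharpolyAt v (P.map (Valued.v : Valuation (PadicAlgCl ℓ) NNReal).valuationSubring.subtype) ∧ ρ'.HasFrobCharpolyAt v (P'.map (Valued.v : Valuation (PadicAlgCl ℓ) NNReal).valuationSubring.subtype) ∧ P.map (IsLocalRing.residue (Valued.v : Valuation (PadicAlgCl ℓ) NNReal).valuationSubring) = P'.map (IsLocalRing.residue (Valued.v : Valuation (PadicAlgCl ℓ) NNReal).valuationSubring)) → ∃ π : Literature.NumberTheory.Automorphic.CuspidalAutomorphicRepData m K hcpt, π.1.IsLAlgebraic ∧ ∀ᶠ v : IsDedekindDomain.HeightOneSpectrum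 (NumberField.RingOfIntegers K) in cofinite, SatakeFrobCompatibleAt ι π.1 ρ v) → ∀ (ℓ : ℕ) [Fact ℓ.Prime] (ι : PadicAlgCl ℓ ≃+* ℂ) (ρ : Literature.NumberTheory.GaloisRepresentations.FramedGaloisRep K (PadicAlgCl ℓ) n), 2 * (n + 1) ≤ ℓ → (ρ.restrictField (CyclotomicField ℓ K)).IsResiduallyAbsIrreducible → ρ.toGaloisRep.IsIrreducible → ((∀ᶠ v : IsDedekindDomain.HeightOneSpectrum (NumberField.RingOfIntegers K) in cofinite, ρ.IsUnramifiedAt v) ∧ ∀ (v : IsDedekindDomain.HeightOneSpectrum (NumberField.RingOfIntegers K)) (hv : ((ℓ : ℕ) : NumberField.RingOfIntegers K) ∈ v.asIdeal), (Literature.NumberTheory.PAdicHodge.fontainePstAdicCompletion v ℓ hv).IsDeRhamFramed (ρ.toLocal v)) → (∃ (π : Literature.NumberTheory.Automorphic.CuspidalAutomorphicRepData n K hcpt) (ρ' : Literature.NumberTheory.GaloisRepresentations.FramedGaloisRep K (PadicAlgCl ℓ) n), π.1.IsLAlgebraic ∧ ρ'.toGaloisRep.IsIrreducible ∧ (∀ᶠ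 v : IsDedekindDomain.HeightOneSpectrum (NumberField.RingOfIntegers K) in cofinite, SatakeFrobCompatibleAt ι π.1 ρ' v) ∧ ∀ᶠ v : IsDedekindDomain.HeightOneSpectrum (NumberField.RingOfIntegers K) in cofinite, ∃ P P' : Polynomial (Valued.v : Valuation (PadicAlgCl ℓ) NNReal).valuationSubring, ρ.HasFrobCharpolyAt v (P.map (Valued.v : Valuation (PadicAlgCl ℓ) NNReal).valuationSubring.subtype) ∧ ρ'.HasFrobCharpolyAt v (P'.map (Valued.v : Valuation (PadicAlgCl ℓ) NNReal).valuationSubring.subtype) ∧ P.map (IsLocalRing.residue (Valued.v : Valuation (PadicAlgCl ℓ) NNReal).valuationSubring) = P'.map (IsLocalRing.residue (Valued.v : Valuation (PadicAlgCl ℓ) NNReal).valuationSubring)) → ∃ π : Literature.NumberTheory.Automorphic.CuspidalAutomorphicRepData n K hcpt, π.1.IsLAlgebraic ∧ ∀ᶠ v : IsDedekindDomain.HeightOneSpectrum (NumberField.RingOfIntegers K) in cofinite, SatakeFrobCompatibleAt ι π.1 ρ v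

-- parent: AutomorphyLifting · child (gen 2)
/--     item stmt-Langlands-33907 · crux · rank 402 · open
    parent: AutomorphyLifting · by planner
    why it might fail: Below 2(n+1) the image of ρ̄|Γ_{K(ζ_ℓ)} can be absolutely irreducible yet inadequate (SL₂(𝔽_ℓ) on Sym^{n−1}, n=(ℓ−1)/2; ℓ ∣ n); there patching has no Taylor–Wiles primes and only sporadic n = 2 repairs exist (Khare–Thorne at ℓ = 5); one such ρ of rank ≥ 3 refutes it.
    sources: GuralnickHerzigTiep2015, arXiv:1311.1786, Thorne2012, GuralnickHerzigTiep2017, Kisin2009, KhareThorne2016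
[crux · FINITE RANGE of the residual-image axis · WEAKER · INSTRUMENTABLE (adequacy sub-dial) /
IDEA-NEEDED (inadequate core)] F† — the same Lift_w instances with ℓ < 2(n+1) AND ρ̄|Γ_{K(ζ_ℓ)}
absolutely irreducible, under the same rank-induction hypothesis. Per rank a FINITE set of primes
(n=2: {2,3,5}; n=3: {2,3,5,7}; n=4: {2,3,5,7}; n=5: {2,…,11}; kernel Cert.finiteRange_table), in
which absolute irreducibility no longer forces adequacy — the threshold is SHARP
(Guralnick–Herzig–Tiep 2015 Thm 1.1 «best possible»: SL₂(𝔽_ℓ) on Sym^{n−1}, n = (ℓ−1)/2) and the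
failures are CATALOGUED (GHT15 Thm 1.2/1.3, Cor 1.4/1.5: ℓ ∣ n never adequate = tree
Subgroup.not_isThorneAdequate_of_natCast_eq_zero; PSL₂(ℓ) in dim (ℓ±1)/2, SL₂(ℓ)×SL₂(ℓ^a),
(3A₆,5,3), (2A₇,7,4), (SL₂(3^a),3,2); tree facts GuralnickHerzigTiep2017_thm_1_7/_cor_9_4/_cor_9_5).
INSTRUMENT: the sub-dial Subgroup.IsThorneAdequate (tree AdequateSubgroup) of the image of
ρ̄|Γ_{K(ζ_ℓ)} — adequate instances fall to the same engines verbatim (Thorne 2012 Thm 7.1 = BLGGT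
Thm 2.2.1 is stated for adequate images at any odd ℓ); the INADEQUATE CORE is idea-needed: n=2, ℓ=3
(proj. image PSL₂(𝔽₃)), ℓ=5 with ρ̄(Γ_{K(ζ₅)}) ∼ SL₂(𝔽₅) (Kisin 2009 -/
@[route_item "route-Langlands-OdlyzkoWorldSplit"]
def IrreducibleSmallPrimeLifting : Prop :=
  ∀ (K : Type) [Field K] [NumberField K] (n : ℕ) (hcpt : Literature.NumberTheory.Automorphic.isCompact_glFiniteIntegralLevel n K), 0 < n → (∀ m : ℕ, m < n → ∀ (K : Type) [Field K] [NumberField K] (hcpt : Literature.NumberTheory.Automorphic.isCompact_glFiniteIntegralLevel m K), 0 < m → ∀ (ℓ : ℕ) [Fact ℓ.Prime] (ι : PadicAlgCl ℓ ≃+* ℂ) (ρ : Literature.NumberTheory.GaloisRepresentations.FramedGaloisRep K (PadicAlgCl ℓ) m), ρ.toGaloisRep.IsIrreducible → ((∀ᶠ v : IsDedekindDomain.HeightOneSpectrum (NumberField.RingOfIntegers K) in cofinite, ρ.IsUnramifiedAt v) ∧ ∀ (v : IsDedekindDomain.HeightOneSpectrum (NumberField.RingOfIntegers K)) (hv : ((ℓ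 : ℕ) : NumberField.RingOfIntegers K) ∈ v.asIdeal), (Literature.NumberTheory.PAdicHodge.fontainePstAdicCompletion v ℓ hv).IsDeRhamFramed (ρ.toLocal v)) → (∃ (π : Literature.NumberTheory.Automorphic.CuspidalAutomorphicRepData m K hcpt) (ρ' : Literature.NumberTheory.GaloisRepresentations.FramedGaloisRep K (PadicAlgCl ℓ) m), π.1.IsLAlgebraic ∧ ρ'.toGaloisRep.IsIrreducible ∧ (∀ᶠ v : IsDedekindDomain.HeightOneSpectrum (NumberField.RingOfIntegers K) in cofinite, SatakeFrobCompatibleAt ι π.1 ρ' v) ∧ ∀ᶠ v : IsDedekindDomain.HeightOneSpectrum (NumberField.RingOfIntegers K) in cofinite, ∃ P P' : Polynomial (Valued.v : Valuation (PadicAlgCl ℓ) NNReal).valuationSubring, ρ.HasFrobCharpolyAt v (P.map (Valued.v : Valuation (PadicAlgCl ℓ) NNReal).valuationSubring.subtype) ∧ ρ'.HasFrobCharpolyAt v (P'.map (Valued.v : Valuation (PadicAlgCl ℓ) NNReal).valuationSubring.subtype) ∧ P.map (IsLocalRing.residue (Valued.v : Valuation (PadicAlgCl ℓ) NNReal).valuationSubring)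 = P'.map (IsLocalRing.residue (Valued.v : Valuation (PadicAlgCl ℓ) NNReal).valuationSubring)) → ∃ π : Literature.NumberTheory.Automorphic.CuspidalAutomorphicRepData m K hcpt, π.1.IsLAlgebraic ∧ ∀ᶠ v : IsDedekindDomain.HeightOneSpectrum (NumberField.RingOfIntegers K) in cofinite, SatakeFrobCompatibleAt ι π.1 ρ v) → ∀ (ℓ : ℕ) [Fact ℓ.Prime] (ι : PadicAlgCl ℓ ≃+* ℂ) (ρ : Literature.NumberTheory.GaloisRepresentations.FramedGaloisRep K (PadicAlgCl ℓ) n), ℓ < 2 * (n + 1) → (ρ.restrictField (CyclotomicField ℓ K)).IsResiduallyAbsIrreducible → ρ.toGaloisRep.IsIrreducible → ((∀ᶠ v : IsDedekindDomain.HeightOneSpectrum (NumberField.RingOfIntegers K) in cofinite, ρ.IsUnramifiedAt v) ∧ ∀ (v : IsDedekindDomain.HeightOneSpectrum (NumberField.RingOfIntegers K)) (hv : ((ℓ : ℕ) : NumberField.RingOfIntegers K) ∈ v.asIdeal), (Literature.NumberTheory.PAdicHodge.fontainePstAdicCompletion v ℓ hv).IsDeRhamFramed (ρ.toLocal v)) →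 (∃ (π : Literature.NumberTheory.Automorphic.CuspidalAutomorphicRepData n K hcpt) (ρ' : Literature.NumberTheory.GaloisRepresentations.FramedGaloisRep K (PadicAlgCl ℓ) n), π.1.IsLAlgebraic ∧ ρ'.toGaloisRep.IsIrreducible ∧ (∀ᶠ v : IsDedekindDomain.HeightOneSpectrum (NumberField.RingOfIntegers K) in cofinite, SatakeFrobCompatibleAt ι π.1 ρ' v) ∧ ∀ᶠ v : IsDedekindDomain.HeightOneSpectrum (NumberField.RingOfIntegers K) in cofinite, ∃ P P' : Polynomial (Valued.v : Valuation (PadicAlgCl ℓ) NNReal).valuationSubring, ρ.HasFrobCharpolyAt v (P.map (Valued.v : Valuation (PadicAlgCl ℓ) NNReal).valuationSubring.subtype) ∧ ρ'.HasFrobCharpolyAt v (P'.map (Valued.v : Valuation (PadicAlgCl ℓ) NNReal).valuationSubring.subtype) ∧ P.map (IsLocalRing.residue (Valued.v : Valuation (PadicAlgCl ℓ) NNReal).valuationSubring) = P'.map (IsLocalRing.residue (Valued.v : Valuation (PadicAlgCl ℓ) NNReal).valuationSubring)) → ∃ π : Literature.NumberTheory.Automorphic.CuspidalAutomorphicRepData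 n K hcpt, π.1.IsLAlgebraic ∧ ∀ᶠ v : IsDedekindDomain.HeightOneSpectrum (NumberField.RingOfIntegers K) in cofinite, SatakeFrobCompatibleAt ι π.1 ρ v

-- parent: AutomorphyLifting · child (gen 2)
/--     item stmt-Langlands-33908 · crux · rank 403 · open
    parent: AutomorphyLifting · by planner
    why it might fail: Residually reducible ordinary lifting is printed only for GL₂ over totally real K (Skinner–Wiles) and for unitary-type ρ over CM fields with a Steinberg place (Thorne, Allen–Newton–Thorne); a non-polarisable ordinary Eisenstein-congruent ρ of rank 3 over a CM field has no method.
    sources: SkinnerWiles1999, SkinnerWiles2001, Thorne2015JAMS, AllenNewtonThorne2020, Pan2022, arXiv:2109.14145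
[crux · SLOPE re-cut of the g8 residual R† (CyclotomicReducibleLifting 33367, retired by this
resplit; R† ⟺ RPO ∧ RNO₂ ∧ RNO₃ kernel-certified) · WEAKER · ATTACKABLE-BY-ENGINE] RPO — R† (under
IH «Lift_w at every rank m < n»: an irreducible geometric ρ : Γ_K → GL_n(ℚ̄_ℓ) with ρ̄|Γ_{K(ζ_ℓ)}
absolutely REDUCIBLE, congruent mod 𝔪 a.e. to an irreducible weakly automorphic ρ', is weakly
automorphic) RESTRICTED to the instances that are POTENTIALLY ORDINARY WITH REGULAR LABELLED WEIGHTS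
over some finite solvable Galois L/K (the tree's inlined IsPotentiallyOrdinary clause of
ResidualAvatarLadder.CoreReducibleOrdinaryAutomorphy 31186 VERBATIM: at every w ∣ ℓ of L, ρ|Γ_{L_w}
conjugate to upper-triangular with de Rham diagonal characters of strictly increasing single
labelled Hodge–Tate weights). Every rank. This is exactly the printed scope of the
residually-REDUCIBLE engines, all ordinary: Skinner–Wiles 1999/2001 (GL₂ over totally real K, Λ-adic
Hida-family patching), Thorne 2015 + Allen–Newton–Thorne 2020 (tree fact
Literature.NumberTheory.Automorphic.AllenNewtonThorne2020.automorphyLifting_residuallyReducible_ordinary: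
imaginary CM, unitary type, ordinary, Steinberg place, Schur residual -/
@[route_item "route-Langlands-OdlyzkoWorldSplit"]
def CyclotomicReducibleOrdinaryLifting : Prop :=
  ∀ (K : Type) [Field K] [NumberField K] (n : ℕ) (hcpt : Literature.NumberTheory.Automorphic.isCompact_glFiniteIntegralLevel n K), 0 < n → (∀ m : ℕ, m < n → ∀ (K : Type) [Field K] [NumberField K] (hcpt : Literature.NumberTheory.Automorphic.isCompact_glFiniteIntegralLevel m K), 0 < m → ∀ (ℓ : ℕ) [Fact ℓ.Prime] (ι : PadicAlgCl ℓ ≃+* ℂ) (ρ : Literature.NumberTheory.GaloisRepresentations.FramedGaloisRep K (PadicAlgCl ℓ) m), ρ.toGaloisRep.IsIrreducible → ((∀ᶠ v : IsDedekindDomain.HeightOneSpectrum (NumberField.RingOfIntegers K) in cofinite, ρ.IsUnramifiedAt v) ∧ ∀ (v : IsDedekindDomain.HeightOneSpectrum (NumberField.RingOfIntegers K)) (hv : ((ℓ : ℕ) : NumberField.RingOfIntegers K) ∈ v.asIdeal), (Literature.NumberTheory.PAdicHodge.fontainePstAdicCompletion v ℓ hv).IsDeRhamFramed (ρ.toLocal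 v)) → (∃ (π : Literature.NumberTheory.Automorphic.CuspidalAutomorphicRepData m K hcpt) (ρ' : Literature.NumberTheory.GaloisRepresentations.FramedGaloisRep K (PadicAlgCl ℓ) m), π.1.IsLAlgebraic ∧ ρ'.toGaloisRep.IsIrreducible ∧ (∀ᶠ v : IsDedekindDomain.HeightOneSpectrum (NumberField.RingOfIntegers K) in cofinite, SatakeFrobCompatibleAt ι π.1 ρ' v) ∧ ∀ᶠ v : IsDedekindDomain.HeightOneSpectrum (NumberField.RingOfIntegers K) in cofinite, ∃ P P' : Polynomial (Valued.v : Valuation (PadicAlgCl ℓ) NNReal).valuationSubring, ρ.HasFrobCharpolyAt v (P.map (Valued.v : Valuation (PadicAlgCl ℓ) NNReal).valuationSubring.subtype) ∧ ρ'.HasFrobCharpolyAt v (P'.map (Valued.v : Valuation (PadicAlgCl ℓ) NNReal).valuationSubring.subtype) ∧ P.map (IsLocalRing.residue (Valued.v : Valuation (PadicAlgCl ℓ) NNReal).valuationSubring) = P'.map (IsLocalRing.residue (Valued.v : Valuation (PadicAlgCl ℓ) NNReal).valuationSubring)) → ∃ π : Literature.NumberTheory.Automorphic.CuspidalAutomorphicRepData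 m K hcpt, π.1.IsLAlgebraic ∧ ∀ᶠ v : IsDedekindDomain.HeightOneSpectrum (NumberField.RingOfIntegers K) in cofinite, SatakeFrobCompatibleAt ι π.1 ρ v) → ∀ (ℓ : ℕ) [Fact ℓ.Prime] (ι : PadicAlgCl ℓ ≃+* ℂ) (ρ : Literature.NumberTheory.GaloisRepresentations.FramedGaloisRep K (PadicAlgCl ℓ) n), ¬ (ρ.restrictField (CyclotomicField ℓ K)).IsResiduallyAbsIrreducible → (∃ (L : Type) (_ : Field L) (_ : NumberField L) (_ : Algebra K L), IsGalois K L ∧ IsSolvable (L ≃ₐ[K] L) ∧ ∀ (w : IsDedekindDomain.HeightOneSpectrum (NumberField.RingOfIntegers L)) (hw : ((ℓ : ℕ) : NumberField.RingOfIntegers L) ∈ w.asIdeal), letI := (Literature.NumberTheory.PAdicHodge.fontainePstAdicCompletion w ℓ hw).algebra; ∃ (g : GL (Fin n) (PadicAlgCl ℓ)) (ψ : Fin n → Literature.NumberTheory.GaloisRepresentations.FramedGaloisRep (w.adicCompletion L) (PadicAlgCl ℓ) 1) (a : Fin n → ((w.adicCompletion L) →ₐ[ℚ_[ℓ]] PadicAlgCl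 ℓ) → ℤ), Literature.NumberTheory.GaloisRepresentations.FramedRep.IsUpperTriangular (((ρ.restrictField L).toLocal w).conj g) ∧ (∀ (σ : Field.absoluteGaloisGroup (w.adicCompletion L)) (i : Fin n), Literature.NumberTheory.GaloisRepresentations.FramedRep.diagEntry (((ρ.restrictField L).toLocal w).conj g) i σ = (ψ i).trace σ) ∧ (∀ i : Fin n, (Literature.NumberTheory.PAdicHodge.fontainePstAdicCompletion w ℓ hw).IsDeRhamFramed (ψ i)) ∧ (∀ (i : Fin n) (τ : (w.adicCompletion L) →ₐ[ℚ_[ℓ]] PadicAlgCl ℓ), (Literature.NumberTheory.PAdicHodge.fontainePstAdicCompletion w ℓ hw).𝔅.labelledHodgeTateWeights (ψ i).toGaloisRep τ.toRingHom = {a i τ}) ∧ (∀ τ : (w.adicCompletion L) →ₐ[ℚ_[ℓ]] PadicAlgCl ℓ, StrictMono (fun i : Fin n => a i τ))) → ρ.toGaloisRep.IsIrreducible → ((∀ᶠ v : IsDedekindDomain.HeightOneSpectrum (NumberField.RingOfIntegers K) in cofinite, ρ.IsUnramifiedAt v) ∧ ∀ (v : IsDedekindDomain.HeightOneSpectrum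 (NumberField.RingOfIntegers K)) (hv : ((ℓ : ℕ) : NumberField.RingOfIntegers K) ∈ v.asIdeal), (Literature.NumberTheory.PAdicHodge.fontainePstAdicCompletion v ℓ hv).IsDeRhamFramed (ρ.toLocal v)) → (∃ (π : Literature.NumberTheory.Automorphic.CuspidalAutomorphicRepData n K hcpt) (ρ' : Literature.NumberTheory.GaloisRepresentations.FramedGaloisRep K (PadicAlgCl ℓ) n), π.1.IsLAlgebraic ∧ ρ'.toGaloisRep.IsIrreducible ∧ (∀ᶠ v : IsDedekindDomain.HeightOneSpectrum (NumberField.RingOfIntegers K) in cofinite, SatakeFrobCompatibleAt ι π.1 ρ' v) ∧ ∀ᶠ v : IsDedekindDomain.HeightOneSpectrum (NumberField.RingOfIntegers K) in cofinite, ∃ P P' : Polynomial (Valued.v : Valuation (PadicAlgCl ℓ) NNReal).valuationSubring, ρ.HasFrobCharpolyAt v (P.map (Valued.v : Valuation (PadicAlgCl ℓ) NNReal).valuationSubring.subtype) ∧ ρ'.HasFrobCharpolyAt v (P'.map (Valued.v : Valuation (PadicAlgCl ℓ) NNReal).valuationSubring.subtype) ∧ P.map (IsLocalRing.residue (Valued.v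 : Valuation (PadicAlgCl ℓ) NNReal).valuationSubring) = P'.map (IsLocalRing.residue (Valued.v : Valuation (PadicAlgCl ℓ) NNReal).valuationSubring)) → ∃ π : Literature.NumberTheory.Automorphic.CuspidalAutomorphicRepData n K hcpt, π.1.IsLAlgebraic ∧ ∀ᶠ v : IsDedekindDomain.HeightOneSpectrum (NumberField.RingOfIntegers K) in cofinite, SatakeFrobCompatibleAt ι π.1 ρ v

-- parent: AutomorphyLifting · child (gen 2)
/--     item stmt-Langlands-33909 · crux · rank 404 · open
    parent: AutomorphyLifting · by planner
    why it might fail: Off K_v = ℚ_ℓ there is no p-adic local Langlands correspondence to run Pan's argument (ModPLanglandsGL2BeyondQp, Paškūnas centre-finiteness fails), and even 2-dimensional Artin-type avatars over non-CM K sit here; one non-automorphic such ρ refutes it.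
    sources: Pan2022, arXiv:1901.07166, Tung2021, Paskunas2015, Edixhoven1992, BergerLiJunezhu2004
[crux · BASE RANGE n ≤ 2 of R†'s rank induction · WEAKER · RESIDUAL-WITH-RUNG (Pan 2022) · FINITE
ℓ-RANGE per Hodge–Tate gap at ℚ_ℓ-crystalline places] RNO₂ — the same R† instances of rank n ≤ 2
that are NOT potentially ordinary with regular labelled weights (non-ordinary, or
irregular/Artin-type weights). RUNG (decided where Langlands is not): Pan 2022 Thm 1.0.2
[corpus:paper:arxiv-1901.07166 p.3] — K = ℚ, ℓ odd, ρ : Γ_ℚ → GL₂ odd irreducible, pst at ℓ with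
distinct Hodge–Tate weights, ρ̄^ss = χ̄₁ ⊕ χ̄₂ (ℓ = 3: χ̄₁/χ̄₂|D₃ ≠ ω) ⟹ modular, ordinary or NOT,
by p-adic local Langlands for GL₂(ℚ_ℓ) + pseudo-representation patching (Tung 2021 / Paškūnas–Tung
towards ℓ ∈ {2,3}). BRIDGE (lens 5): at a place v ∣ ℓ with K_v = ℚ_ℓ and ρ|Γ_{K_v} crystalline of
Hodge–Tate weights {0, r}, 1 ≤ r ≤ ℓ, NON-ordinary forces ρ̄|Γ_{K_v} ≅ unramified twist of Ind ω₂^r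
(Fontaine–Laffaille; Edixhoven 1992 Thm 2.5/2.6
[corpus:book:cornell1997-modular-forms-fermats-last-theorem p.297]; r = ℓ: Berger–Li–Zhu 2004
[corpus:paper:doi-10-4007-annals-2009-169-229 p.11 Prop 3.2]), irreducible on Γ_{ℚ_ℓ(ζ_ℓ)} unless ℓ
= 2r − 1 (Mackey) — so the cyclotomic-reducible non-ordinary darkness at such places is the FINITE -/
@[route_item "route-Langlands-OdlyzkoWorldSplit"]
def CyclotomicReducibleNonOrdinaryRankTwoLifting : Prop :=
  ∀ (K : Type) [Field K] [NumberField K] (n : ℕ) (hcpt : Literature.NumberTheory.Automorphic.isCompact_glFiniteIntegralLevel n K), 0 < n → n ≤ 2 → (∀ m : ℕ, m < n → ∀ (K : Type) [Field K] [NumberField K] (hcpt : Literature.NumberTheory.Automorphic.isCompact_glFiniteIntegralLevel m K), 0 < m → ∀ (ℓ : ℕ) [Fact ℓ.Prime] (ι : PadicAlgCl ℓ ≃+* ℂ) (ρ : Literature.NumberTheory.GaloisRepresentations.FramedGaloisRep K (PadicAlgCl ℓ) m), ρ.toGaloisRep.IsIrreducible → ((∀ᶠ v : IsDedekindDomain.HeightOneSpectrum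 (NumberField.RingOfIntegers K) in cofinite, ρ.IsUnramifiedAt v) ∧ ∀ (v : IsDedekindDomain.HeightOneSpectrum (NumberField.RingOfIntegers K)) (hv : ((ℓ : ℕ) : NumberField.RingOfIntegers K) ∈ v.asIdeal), (Literature.NumberTheory.PAdicHodge.fontainePstAdicCompletion v ℓ hv).IsDeRhamFramed (ρ.toLocal v)) → (∃ (π : Literature.NumberTheory.Automorphic.CuspidalAutomorphicRepData m K hcpt) (ρ' : Literature.NumberTheory.GaloisRepresentations.FramedGaloisRep K (PadicAlgCl ℓ) m), π.1.IsLAlgebraic ∧ ρ'.toGaloisRep.IsIrreducible ∧ (∀ᶠ v : IsDedekindDomain.HeightOneSpectrum (NumberField.RingOfIntegers K) in cofinite, SatakeFrobCompatibleAt ι π.1 ρ' v) ∧ ∀ᶠ v : IsDedekindDomain.HeightOneSpectrum (NumberField.RingOfIntegers K) in cofinite, ∃ P P' : Polynomial (Valued.v : Valuation (PadicAlgCl ℓ) NNReal).valuationSubring, ρ.HasFrobCharpolyAt v (P.map (Valued.v : Valuation (PadicAlgCl ℓ) NNReal).valuationSubring.subtype) ∧ ρ'.HasFrobCharpolyAt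 v (P'.map (Valued.v : Valuation (PadicAlgCl ℓ) NNReal).valuationSubring.subtype) ∧ P.map (IsLocalRing.residue (Valued.v : Valuation (PadicAlgCl ℓ) NNReal).valuationSubring) = P'.map (IsLocalRing.residue (Valued.v : Valuation (PadicAlgCl ℓ) NNReal).valuationSubring)) → ∃ π : Literature.NumberTheory.Automorphic.CuspidalAutomorphicRepData m K hcpt, π.1.IsLAlgebraic ∧ ∀ᶠ v : IsDedekindDomain.HeightOneSpectrum (NumberField.RingOfIntegers K) in cofinite, SatakeFrobCompatibleAt ι π.1 ρ v) → ∀ (ℓ : ℕ) [Fact ℓ.Prime] (ι : PadicAlgCl ℓ ≃+* ℂ) (ρ : Literature.NumberTheory.GaloisRepresentations.FramedGaloisRep K (PadicAlgCl ℓ) n), ¬ (ρ.restrictField (CyclotomicField ℓ K)).IsResiduallyAbsIrreducible → ¬ (∃ (L : Type) (_ : Field L) (_ : NumberField L) (_ : Algebra K L), IsGalois K L ∧ IsSolvable (L ≃ₐ[K] L) ∧ ∀ (w : IsDedekindDomain.HeightOneSpectrum (NumberField.RingOfIntegers L)) (hw : ((ℓ : ℕ) : NumberField.RingOfIntegers L)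 ∈ w.asIdeal), letI := (Literature.NumberTheory.PAdicHodge.fontainePstAdicCompletion w ℓ hw).algebra; ∃ (g : GL (Fin n) (PadicAlgCl ℓ)) (ψ : Fin n → Literature.NumberTheory.GaloisRepresentations.FramedGaloisRep (w.adicCompletion L) (PadicAlgCl ℓ) 1) (a : Fin n → ((w.adicCompletion L) →ₐ[ℚ_[ℓ]] PadicAlgCl ℓ) → ℤ), Literature.NumberTheory.GaloisRepresentations.FramedRep.IsUpperTriangular (((ρ.restrictField L).toLocal w).conj g) ∧ (∀ (σ : Field.absoluteGaloisGroup (w.adicCompletion L)) (i : Fin n), Literature.NumberTheory.GaloisRepresentations.FramedRep.diagEntry (((ρ.restrictField L).toLocal w).conj g) i σ = (ψ i).trace σ) ∧ (∀ i : Fin n, (Literature.NumberTheory.PAdicHodge.fontainePstAdicCompletion w ℓ hw).IsDeRhamFramed (ψ i)) ∧ (∀ (i : Fin n) (τ : (w.adicCompletion L) →ₐ[ℚ_[ℓ]] PadicAlgCl ℓ), (Literature.NumberTheory.PAdicHodge.fontainePstAdicCompletion w ℓ hw).𝔅.labelledHodgeTateWeights (ψ i).toGaloisRep τ.toRingHom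 = {a i τ}) ∧ (∀ τ : (w.adicCompletion L) →ₐ[ℚ_[ℓ]] PadicAlgCl ℓ, StrictMono (fun i : Fin n => a i τ))) → ρ.toGaloisRep.IsIrreducible → ((∀ᶠ v : IsDedekindDomain.HeightOneSpectrum (NumberField.RingOfIntegers K) in cofinite, ρ.IsUnramifiedAt v) ∧ ∀ (v : IsDedekindDomain.HeightOneSpectrum (NumberField.RingOfIntegers K)) (hv : ((ℓ : ℕ) : NumberField.RingOfIntegers K) ∈ v.asIdeal), (Literature.NumberTheory.PAdicHodge.fontainePstAdicCompletion v ℓ hv).IsDeRhamFramed (ρ.toLocal v)) → (∃ (π : Literature.NumberTheory.Automorphic.CuspidalAutomorphicRepData n K hcpt) (ρ' : Literature.NumberTheory.GaloisRepresentations.FramedGaloisRep K (PadicAlgCl ℓ) n), π.1.IsLAlgebraic ∧ ρ'.toGaloisRep.IsIrreducible ∧ (∀ᶠ v : IsDedekindDomain.HeightOneSpectrum (NumberField.RingOfIntegers K) in cofinite, SatakeFrobCompatibleAt ι π.1 ρ' v) ∧ ∀ᶠ v : IsDedekindDomain.HeightOneSpectrum (NumberField.RingOfIntegers K) in cofinite,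 ∃ P P' : Polynomial (Valued.v : Valuation (PadicAlgCl ℓ) NNReal).valuationSubring, ρ.HasFrobCharpolyAt v (P.map (Valued.v : Valuation (PadicAlgCl ℓ) NNReal).valuationSubring.subtype) ∧ ρ'.HasFrobCharpolyAt v (P'.map (Valued.v : Valuation (PadicAlgCl ℓ) NNReal).valuationSubring.subtype) ∧ P.map (IsLocalRing.residue (Valued.v : Valuation (PadicAlgCl ℓ) NNReal).valuationSubring) = P'.map (IsLocalRing.residue (Valued.v : Valuation (PadicAlgCl ℓ) NNReal).valuationSubring)) → ∃ π : Literature.NumberTheory.Automorphic.CuspidalAutomorphicRepData n K hcpt, π.1.IsLAlgebraic ∧ ∀ᶠ v : IsDedekindDomain.HeightOneSpectrum (NumberField.RingOfIntegers K) in cofinite, SatakeFrobCompatibleAt ι π.1 ρ v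

-- parent: AutomorphyLifting · child (gen 2)
/--     item stmt-Langlands-33910 · crux · rank 405 · open
    parent: AutomorphyLifting · by planner
    why it might fail: No automorphy lifting method exists for non-ordinary residually reducible ρ of rank ≥ 3 over any field (no Hida family, no p-adic local Langlands beyond GL₂(ℚ_p), no Taylor–Wiles primes); a single non-automorphic such ρ congruent to a cuspidal one refutes it.
    sources: Thorne2015JAMS, AllenNewtonThorne2020, arXiv:2109.14145, Pan2022, Literature.Barriers.Langlands.ResiduallyReducibleBarrier, Literature.Barriers.Langlands.ModPLanglandsGL2BeyondQp
[crux · ASYMPTOTIC RANK 3 ≤ n · DECLARED RESIDUAL of the slope re-cut · WEAKER · BARRIERS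
ResiduallyReducibleBarrier + ModPLanglandsGL2BeyondQp head-on] RNO₃ — the same R† instances of rank
n ≥ 3 that are NOT potentially ordinary with regular labelled weights. NO engine and NO rung in
print: every residually reducible automorphy lifting theorem in rank ≥ 3 is ordinary (Thorne 2015,
Allen–Newton–Thorne 2020; Calegari's survey §3/§9.8 [corpus:paper:arxiv-2109.14145 p.7, p.20]);
Pan's non-ordinary method needs the p-adic local Langlands correspondence, which does not exist
beyond GL₂(ℚ_p); the Taylor–Wiles image hypotheses fail by proved linear algebra
(ResiduallyReducibleBarrier.not_taylorWilesImageHypotheses_of_isDecomposable). The inlined IH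
«Lift_w at every rank m < n» carries content here: imprimitive instances ρ ≅ Ind_M^K τ (M ⊆ K(ζ_ℓ))
whose inducing datum is itself linked over M are met at rank n/[M:K] (critic row 127 h4 caveat: only
linked inducing data) — the one bridge from the base range upward; the primitive non-ordinary
cyclotomic-reducible core of rank ≥ 3 (e.g. Sym² of a non-ordinary Eisenstein-congruent eigenform at
a dark prime ℓ ∈ D(k−1)) is dark. Orbit-closed (rank -/
@[route_item "route-Langlands-OdlyzkoWorldSplit"]
def CyclotomicReducibleNonOrdinaryHigherRankLifting : Prop :=
  ∀ (K : Type) [Field K] [NumberField K] (n : ℕ) (hcpt : Literature.NumberTheory.Automorphic.isCompact_glFiniteIntegralLevel n K), 0 < n → 3 ≤ n → (∀ m : ℕ, m < n → ∀ (K : Type) [Field K] [NumberField K] (hcpt : Literature.NumberTheory.Automorphic.isCompact_glFiniteIntegralLevel m K), 0 < m → ∀ (ℓ : ℕ) [Fact ℓ.Prime] (ι : PadicAlgCl ℓ ≃+* ℂ) (ρ : Literature.NumberTheory.GaloisRepresentations.FramedGaloisRep K (PadicAlgCl ℓ) m), ρ.toGaloisRep.IsIrreducible → ((∀ᶠ v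 : IsDedekindDomain.HeightOneSpectrum (NumberField.RingOfIntegers K) in cofinite, ρ.IsUnramifiedAt v) ∧ ∀ (v : IsDedekindDomain.HeightOneSpectrum (NumberField.RingOfIntegers K)) (hv : ((ℓ : ℕ) : NumberField.RingOfIntegers K) ∈ v.asIdeal), (Literature.NumberTheory.PAdicHodge.fontainePstAdicCompletion v ℓ hv).IsDeRhamFramed (ρ.toLocal v)) → (∃ (π : Literature.NumberTheory.Automorphic.CuspidalAutomorphicRepData m K hcpt) (ρ' : Literature.NumberTheory.GaloisRepresentations.FramedGaloisRep K (PadicAlgCl ℓ) m), π.1.IsLAlgebraic ∧ ρ'.toGaloisRep.IsIrreducible ∧ (∀ᶠ v : IsDedekindDomain.HeightOneSpectrum (NumberField.RingOfIntegers K) in cofinite, SatakeFrobCompatibleAt ι π.1 ρ' v) ∧ ∀ᶠ v : IsDedekindDomain.HeightOneSpectrum (NumberField.RingOfIntegers K) in cofinite, ∃ P P' : Polynomial (Valued.v : Valuation (PadicAlgCl ℓ) NNReal).valuationSubring, ρ.HasFrobCharpolyAt v (P.map (Valued.v : Valuation (PadicAlgCl ℓ) NNReal).valuationSubring.subtype)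 ∧ ρ'.HasFrobCharpolyAt v (P'.map (Valued.v : Valuation (PadicAlgCl ℓ) NNReal).valuationSubring.subtype) ∧ P.map (IsLocalRing.residue (Valued.v : Valuation (PadicAlgCl ℓ) NNReal).valuationSubring) = P'.map (IsLocalRing.residue (Valued.v : Valuation (PadicAlgCl ℓ) NNReal).valuationSubring)) → ∃ π : Literature.NumberTheory.Automorphic.CuspidalAutomorphicRepData m K hcpt, π.1.IsLAlgebraic ∧ ∀ᶠ v : IsDedekindDomain.HeightOneSpectrum (NumberField.RingOfIntegers K) in cofinite, SatakeFrobCompatibleAt ι π.1 ρ v) → ∀ (ℓ : ℕ) [Fact ℓ.Prime] (ι : PadicAlgCl ℓ ≃+* ℂ) (ρ : Literature.NumberTheory.GaloisRepresentations.FramedGaloisRep K (PadicAlgCl ℓ) n), ¬ (ρ.restrictField (CyclotomicField ℓ K)).IsResiduallyAbsIrreducible → ¬ (∃ (L : Type) (_ : Field L) (_ : NumberField L) (_ : Algebra K L), IsGalois K L ∧ IsSolvable (L ≃ₐ[K] L) ∧ ∀ (w : IsDedekindDomain.HeightOneSpectrum (NumberField.RingOfIntegers L)) (hw : ((ℓ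 : ℕ) : NumberField.RingOfIntegers L) ∈ w.asIdeal), letI := (Literature.NumberTheory.PAdicHodge.fontainePstAdicCompletion w ℓ hw).algebra; ∃ (g : GL (Fin n) (PadicAlgCl ℓ)) (ψ : Fin n → Literature.NumberTheory.GaloisRepresentations.FramedGaloisRep (w.adicCompletion L) (PadicAlgCl ℓ) 1) (a : Fin n → ((w.adicCompletion L) →ₐ[ℚ_[ℓ]] PadicAlgCl ℓ) → ℤ), Literature.NumberTheory.GaloisRepresentations.FramedRep.IsUpperTriangular (((ρ.restrictField L).toLocal w).conj g) ∧ (∀ (σ : Field.absoluteGaloisGroup (w.adicCompletion L)) (i : Fin n), Literature.NumberTheory.GaloisRepresentations.FramedRep.diagEntry (((ρ.restrictField L).toLocal w).conj g) i σ = (ψ i).trace σ) ∧ (∀ i : Fin n, (Literature.NumberTheory.PAdicHodge.fontainePstAdicCompletion w ℓ hw).IsDeRhamFramed (ψ i)) ∧ (∀ (i : Fin n) (τ : (w.adicCompletion L) →ₐ[ℚ_[ℓ]] PadicAlgCl ℓ), (Literature.NumberTheory.PAdicHodge.fontainePstAdicCompletion w ℓ hw).𝔅.labelledHodgeTateWeights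 (ψ i).toGaloisRep τ.toRingHom = {a i τ}) ∧ (∀ τ : (w.adicCompletion L) →ₐ[ℚ_[ℓ]] PadicAlgCl ℓ, StrictMono (fun i : Fin n => a i τ))) → ρ.toGaloisRep.IsIrreducible → ((∀ᶠ v : IsDedekindDomain.HeightOneSpectrum (NumberField.RingOfIntegers K) in cofinite, ρ.IsUnramifiedAt v) ∧ ∀ (v : IsDedekindDomain.HeightOneSpectrum (NumberField.RingOfIntegers K)) (hv : ((ℓ : ℕ) : NumberField.RingOfIntegers K) ∈ v.asIdeal), (Literature.NumberTheory.PAdicHodge.fontainePstAdicCompletion v ℓ hv).IsDeRhamFramed (ρ.toLocal v)) → (∃ (π : Literature.NumberTheory.Automorphic.CuspidalAutomorphicRepData n K hcpt) (ρ' : Literature.NumberTheory.GaloisRepresentations.FramedGaloisRep K (PadicAlgCl ℓ) n), π.1.IsLAlgebraic ∧ ρ'.toGaloisRep.IsIrreducible ∧ (∀ᶠ v : IsDedekindDomain.HeightOneSpectrum (NumberField.RingOfIntegers K) in cofinite, SatakeFrobCompatibleAt ι π.1 ρ' v) ∧ ∀ᶠ v : IsDedekindDomain.HeightOneSpectrum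 (NumberField.RingOfIntegers K) in cofinite, ∃ P P' : Polynomial (Valued.v : Valuation (PadicAlgCl ℓ) NNReal).valuationSubring, ρ.HasFrobCharpolyAt v (P.map (Valued.v : Valuation (PadicAlgCl ℓ) NNReal).valuationSubring.subtype) ∧ ρ'.HasFrobCharpolyAt v (P'.map (Valued.v : Valuation (PadicAlgCl ℓ) NNReal).valuationSubring.subtype) ∧ P.map (IsLocalRing.residue (Valued.v : Valuation (PadicAlgCl ℓ) NNReal).valuationSubring) = P'.map (IsLocalRing.residue (Valued.v : Valuation (PadicAlgCl ℓ) NNReal).valuationSubring)) → ∃ π : Literature.NumberTheory.Automorphic.CuspidalAutomorphicRepData n K hcpt, π.1.IsLAlgebraic ∧ ∀ᶠ v : IsDedekindDomain.HeightOneSpectrum (NumberField.RingOfIntegers K) in cofinite, SatakeFrobCompatibleAt ι π.1 ρ v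

-- parent: AutomorphyLifting · glue (gen 2)
/--     item stmt-Langlands-33911 · support · rank 406 · closed · proved by Summit.Langlands.Langlands.Theorems.AutomorphyLifting_of_slopesplit_proof (prover)
    parent: AutomorphyLifting · GLUE: children ⟹ parent · by planner
IrreducibleLargePrimeLifting → IrreducibleSmallPrimeLifting → CyclotomicReducibleOrdinaryLifting →
CyclotomicReducibleNonOrdinaryRankTwoLifting → CyclotomicReducibleNonOrdinaryHigherRankLifting →
AutomorphyLifting — pure logic: strong induction on the rank n (the induction hypothesis IS each
child’s inlined «Lift_w at every rank m < n»), Nat.lt_or_ge ℓ (2(n+1)) on the g8 threshold dial,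
excluded middle on the g8 image dial and on the SlopeLadder clause PotOrd (31186 verbatim),
Nat.lt_or_ge n 3 on the rank base range — no dial ever restated (lens-5-g9 node kernel; certified as
AutomorphyLifting_of_slopesplit_proof in nodes/lens-5-g9-SlopeRankSplit.split_glue.lean and
kit_check.lean, rc 0, axioms standard) -/
@[route_item "route-Langlands-OdlyzkoWorldSplit"]
def AutomorphyLifting_of_slopesplit : Prop :=
  IrreducibleLargePrimeLifting → IrreducibleSmallPrimeLifting → CyclotomicReducibleOrdinaryLifting → CyclotomicReducibleNonOrdinaryRankTwoLifting → CyclotomicReducibleNonOrdinaryHigherRankLifting → AutomorphyLifting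

-- `AutomorphyLifting_of_slopesplit` holds: proved by `Summit.Langlands.Langlands.Theorems.AutomorphyLifting_of_slopesplit_proof` (its module imports this route file, so no `_holds` link can be stated here).

/-- item stmt-Langlands-17415 · crux · rank 5 · open · by planner
why it might fail: No construction of ρ for irregular L-algebraic π or for K neither totally real nor CM; irreducibility open for n ≥ 3 outside polarized / density-one cases.
sources: BuzzardGeeLMS2014, HarrisLanTaylorThorne2016, Scholze2015
[crux] W⁺ — for every number field K, n ≥ 1, every L-algebraic cuspidal π of GL_n(𝔸_K) and every (ℓ,
ι) there is an IRREDUCIBLE ρ : Γ_K → GL_n(ℚ̄_ℓ) Satake–Frobenius compatible with (π, ι) at almost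
all places (Buzzard–Gee Conj. 3.2.2 weak form + Ramakrishnan's cuspidal ⇒ irreducible; Clozel's
Conj. 1.1.1 in arXiv:2607.11763). No de Rham clause, no Rec: ε-free and Rec-free. [difficulty:
open-problem] -/
@[route_item "route-Langlands-OdlyzkoWorldSplit", crux]
def SatakeAvatarExistence : Prop :=
  ∀ (K : Type) [Field K] [NumberField K] (n : ℕ) (hcpt : Literature.NumberTheory.Automorphic.isCompact_glFiniteIntegralLevel n K), 0 < n → ∀ (π : Literature.NumberTheory.Automorphic.CuspidalAutomorphicRepData n K hcpt), π.1.IsLAlgebraic → ∀ (ℓ : ℕ) [Fact ℓ.Prime] (ι : PadicAlgCl ℓ ≃+* ℂ), ∃ ρ : Literature.NumberTheory.GaloisRepresentations.FramedGaloisRep K (PadicAlgCl ℓ) n, ρ.toGaloisRep.IsIrreducible ∧ ∀ᶠ v : IsDedekindDomain.HeightOneSpectrum (NumberField.RingOfIntegers K) in cofinite, SatakeFrobCompatibleAt ι π.1 ρ v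

/-- item stmt-Langlands-17534 · crux · rank 6 · open · by planner
why it might fail: Local–global compatibility at p for non-polarizable regular π over CM fields is known only up to semisimplification / under genericity, and is open for irregular π.
sources: BarnetlambEtAl2014, BuzzardGeeLMS2014, VarmaFMS2024
[crux] P — the PRIME-SWITCH PRINCIPLE for the p-adic member of the automorphic compatible system
(Rec-parametric, Rec-free in content; rev 1, cone repair: stated over the summit's own predicates
only): for π L-algebraic cuspidal on GL_n/K, ρ an irreducible ℓ-adic avatar of (π, ι)
(Satake–Frobenius compatible a.e.) and a place v ∣ ℓ: (i) ρ|_v is de Rham for Fontaine's pinned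
datum; (ii) for EVERY reciprocity datum Rec, every prime ℓ' ∤ v, ι' and every irreducible ℓ'-adic
avatar ρ' of (π, ι'), local–global compatibility of (π, ρ') at v for Rec (read ℓ'-adically,
Grothendieck–Deligne) implies local–global compatibility of (π, ρ) at v for Rec (read through
D_pst). Mathematically (ii) is Fontaine's C_WD for the system {ρ_(π,ι)}: the
Frobenius-semisimplified Weil–Deligne representation at v of the p-adic member, computed by D_pst,
is the common one of the ℓ'-adic members (Saito arXiv:math/0612077 for Hilbert modular forms;
Caraiani 2012/2014 for Shimura varieties; AHTW 2026 Thm 1.2.1 up to semisimplification for regular π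
over CM). Kernel-certified consequence of `Langlands` (bc/SubsOfLanglands.lean); with L∤ at (π, ι',
ρ') it is Taylor's Conj. 7 at v ∣ ℓ — the glue's patching lemma. -/
@[route_item "route-Langlands-OdlyzkoWorldSplit", crux]
def PadicMemberCompatibility : Prop :=
  ∀ (K : Type) [Field K] [NumberField K] (n : ℕ) (hcpt : Literature.NumberTheory.Automorphic.isCompact_glFiniteIntegralLevel n K), 0 < n → ∀ (π : Literature.NumberTheory.Automorphic.CuspidalAutomorphicRepData n K hcpt), π.1.IsLAlgebraic → ∀ (ℓ : ℕ) [Fact ℓ.Prime] (ι : PadicAlgCl ℓ ≃+* ℂ) (ρ : Literature.NumberTheory.GaloisRepresentations.FramedGaloisRep K (PadicAlgCl ℓ) n), ρ.toGaloisRep.IsIrreducible → (∀ᶠ v : IsDedekindDomain.HeightOneSpectrum (NumberField.RingOfIntegers K) in cofinite, SatakeFrobCompatibleAt ι π.1 ρ v) → ∀ (v : IsDedekindDomain.HeightOneSpectrum (NumberField.RingOfIntegers K)) (hv : ((ℓ : ℕ) : NumberField.RingOfIntegers K) ∈ v.asIdeal), (Literature.NumberTheory.PAdicHodge.fontainePstAdicCompletion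 v ℓ hv).IsDeRhamFramed (ρ.toLocal v) ∧ ∀ (Rec : ReciprocityData K) (ℓ' : ℕ) [Fact ℓ'.Prime] (ι' : PadicAlgCl ℓ' ≃+* ℂ) (ρ' : Literature.NumberTheory.GaloisRepresentations.FramedGaloisRep K (PadicAlgCl ℓ') n), ((ℓ' : ℕ) : NumberField.RingOfIntegers K) ∉ v.asIdeal → ρ'.toGaloisRep.IsIrreducible → (∀ᶠ w : IsDedekindDomain.HeightOneSpectrum (NumberField.RingOfIntegers K) in cofinite, SatakeFrobCompatibleAt ι' π.1 ρ' w) → LocalGlobalCompatibleAt Rec ι' π.1 ρ' v → LocalGlobalCompatibleAt Rec ι π.1 ρ v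

/-- item stmt-Langlands-18084 · crux · rank 7 · open · by planner
why it might fail: For non-polarizable π over CM fields compatibility at v ∤ ℓ is known only up to Frobenius-semisimplification and monodromy (Varma); nothing off the regular totally-real/CM sector.
sources: VarmaFMS2024, BuzzardGeeLMS2014, HarrisLanTaylorThorne2016
[crux] L∤R — Taylor 2004 Conj. 7 at the places v ∤ ℓ, in the `∀ Rec` form (rev 4, lockstep re-type
after the summit re-type p141787 `∀ F, Nonempty (ReciprocityData F) ∧ ∀ 𝓡 …`): for every number
field K and EVERY reciprocity datum Rec (Henniart-normalised local Langlands data with THE canonical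
Artin pins — the summit's `∀ 𝓡`), every n ≥ 1 and hcpt, every L-algebraic cuspidal π of GL_n(𝔸_K),
every (ℓ, ι) and every IRREDUCIBLE ρ : Γ_K → GL_n(ℚ̄_ℓ) that is pinned-geometric (unramified a.e.,
de Rham above ℓ for Fontaine's pinned datum) and Satake–Frobenius compatible with (π, ι) a.e.:
`LocalGlobalCompatibleAt Rec ι π ρ v` at every finite v ∤ ℓ (Grothendieck–Deligne Weil–Deligne
representation, Frobenius-semisimplified, ↔ rec_v(π_v)). = item L∤ (stmt-Langlands-17417, ∃-Rec
form; verbatim the registered stub `stub_pairCompatibilityAway` of line `Sketch` of crux 14328) with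
Rec moved from `∃ Rec,` to a universal binder after K and nothing else changed; the ∃-form is
implied back by L∤R ∧ CanonicalReciprocityData (`compatibilityAwayFromL_existsForm`).
Kernel-certified consequence of the re-typed summit (`compatibilityAwayFromLR_of_langlands`, planner
bc/SubsOfLanglandsR.lean: direction (A -/
@[route_item "route-Langlands-OdlyzkoWorldSplit", crux]
def CompatibilityAwayFromLR : Prop :=
  ∀ (K : Type) [Field K] [NumberField K] (Rec : ReciprocityData K) (n : ℕ) (hcpt : Literature.NumberTheory.Automorphic.isCompact_glFiniteIntegralLevel n K), 0 < n → ∀ (π : Literature.NumberTheory.Automorphic.CuspidalAutomorphicRepData n K hcpt), π.1.IsLAlgebraic → ∀ (ℓ : ℕ) [Fact ℓ.Prime] (ι : PadicAlgCl ℓ ≃+* ℂ) (ρ : Literature.NumberTheory.GaloisRepresentations.FramedGaloisRep K (PadicAlgCl ℓ) n), ρ.toGaloisRep.IsIrreducible → ((∀ᶠ v : IsDedekindDomain.HeightOneSpectrum (NumberField.RingOfIntegers K) in cofinite, ρ.IsUnramifiedAt v) ∧ ∀ (v : IsDedekindDomain.HeightOneSpectrum (NumberField.RingOfIntegers K)) (hv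 : ((ℓ : ℕ) : NumberField.RingOfIntegers K) ∈ v.asIdeal), (Literature.NumberTheory.PAdicHodge.fontainePstAdicCompletion v ℓ hv).IsDeRhamFramed (ρ.toLocal v)) → (∀ᶠ v : IsDedekindDomain.HeightOneSpectrum (NumberField.RingOfIntegers K) in cofinite, SatakeFrobCompatibleAt ι π.1 ρ v) → ∀ v : IsDedekindDomain.HeightOneSpectrum (NumberField.RingOfIntegers K), ((ℓ : ℕ) : NumberField.RingOfIntegers K) ∉ v.asIdeal → LocalGlobalCompatibleAt Rec ι π.1 ρ v

/-- item stmt-Langlands-17930 · support · rank 9 · open · by planner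
sources: BuzzardGeeLMS2014, HarrisLanTaylorThorne2016
[support] THE SUMMIT'S NON-VACUITY CONJUNCT, verbatim (statement revision p141787, 2026-08-17:
`Langlands := ∀ F, Nonempty (ReciprocityData F) ∧ ∀ 𝓡 n, 0 < n → ∀ hcpt, GLC n F 𝓡 hcpt`, with
`ReciprocityData` pinned to THE local Artin maps by `llc_isCanonical` / `llc_eps_isCanonical`),
filed by route-repair 5a1bd9af as the explicit INPUT of this route's `∃ RD`-shaped slices
(LiftB2Unram, LiftB2UnramSmallF, LiftB2UnramLargeF, LiftB2UnramSplitP): for every number field F and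
every finite place v, a local Langlands datum for GL_n(F_v) (Harris–Taylor 2001 Thm A; Henniart 2000
Thm 1.2) normalised against THE local Artin map `canonicalArtin (F_v)`, whose ε-system (Deligne 1973
Thm 4.1) is normalised against the canonical Artin map of every finite E/F_v. IN PRINT,
textbook-grade input (Harris–Taylor's Thm A is stated relative to Art_K of local class field
theory); in the TREE not yet derivable — `LocalLanglandsDatum.nonempty` (cite-only) yields a datum
with SOME lawful Artin normalisation, and canonicity needs `IsLocalArtinMap.unique` + the
finite-level reciprocity law for that datum's Artin maps, or canonical variants of
`localLanglands_gl` / `nonempty_localEpsilonSystem` (needs-fact for -/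
@[route_item "route-Langlands-OdlyzkoWorldSplit", crux]
def CanonicalReciprocityData : Prop :=
  ∀ (F : Type) [Field F] [NumberField F], Nonempty (Summit.Langlands.ReciprocityData F)

-- earlier LevelOneDiscriminantCeiling (stmt-Langlands-28529, replaced 2026-08-30T06:00:51Z -> stmt-Langlands-28926): retired by None — ∀ (K : Type) [Field K] [NumberField K] (ℓ : ℕ) [Fact ℓ.Prime] (ρ : Literature.NumberTheory.GaloisRepresentations.FramedGaloisRep K (PadicAlgCl ℓ) 2), (∀ᶠ v : IsDedekindDomain.HeightOneSpectrum (NumberField.RingOfIntegers K) in cofinite, ρ.IsUnramifiedAt v) → (∀ v : I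
/-- item stmt-Langlands-28926 · aside · rank 9 · open · by planner
sources: doi:10.1090/conm/174/01857, doi:10.1006/jnth.2000.2534, doi:10.4171/dms/3/18, Sengun2008, MoonTaguchi2008
[support] (CEIL, the BRIDGE — theorem-grade, provable now; file as `aside`: not in the cone of
`closes`, never staffed as progress) Tate's different bound in Moon's form: an ℓ-adic ρ : Γ_K →
GL₂(ℚ̄_ℓ), a.e. unramified and unramified at every v ∤ ℓ, admits a number field L ⊇ K, Galois over K
(L = M = K(ℙρ̄^ss) will do), splitting ℙρ̄^ss with rd(L) < rd(K)·ℓ^((2ℓ−1)/(ℓ−1)) (8·rd(K) at ℓ = 2,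
3^(5/2) = 15.59·rd(K) at ℓ = 3). Proof: L = fixed field of ℙρ̄^ss refined so that the top layer is
elementary abelian of exponent ℓ over a tame layer (Burnside lift of the ℓ-Sylow of the finite
projective image); per 𝔭 ∣ ℓ the different exponent is < (ℓ/(ℓ−1))·e_𝔭 + 1 ≤ ((2ℓ−1)/(ℓ−1))·e_𝔭
(Moon's Lemma 1 + tame part). Kernel corollary in the node file: CEIL ∧ OW ⟹ Serre_w for level-one
rank-2 ρ over every K with rd(K)·ℓ^((2ℓ−1)/(ℓ−1)) ≤ 4πe^γ (proved outright for K = ℚ, ℓ = 2).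
[difficulty: M] TAGS (crit-1 CLEARED 2026-08-30T05:29:08Z STATUS L211, CRITIC-LEDGER row 50; REV 2
ERRATUM (Galois witness field) NODE L221, CLEARED 05:41:20Z L222, row 53): CEIL = ASIDE (banked,
never staffed as a crux) · THEOREM-GRADE, closed modulo print (Tate / Moon different bound: a rank-2
level-one ρ has a splitting -/
@[route_item "route-Langlands-OdlyzkoWorldSplit"]
def LevelOneDiscriminantCeiling : Prop :=
  ∀ (K : Type) [Field K] [NumberField K] (ℓ : ℕ) [Fact ℓ.Prime] (ρ : Literature.NumberTheory.GaloisRepresentations.FramedGaloisRep K (PadicAlgCl ℓ) 2), (∀ᶠ v : IsDedekindDomain.HeightOneSpectrum (NumberField.RingOfIntegers K) in cofinite, ρ.IsUnramifiedAt v) → (∀ v : IsDedekindDomain.HeightOneSpectrum (NumberField.RingOfIntegers K), ((ℓ : ℕ) : NumberField.RingOfIntegers K) ∉ v.asIdeal → ρ.IsUnramifiedAt v) → ∃ (L : Type) (_ : Field L) (_ : NumberField L) (_ : Algebra K L), IsGalois K L ∧ (|(NumberField.discr L : ℝ)|) ^ ((1 : ℝ) / (Module.finrank ℚ L : ℝ))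 < (|(NumberField.discr K : ℝ)|) ^ ((1 : ℝ) / (Module.finrank ℚ K : ℝ)) * (ℓ : ℝ) ^ (((2 * ℓ - 1 : ℕ) : ℝ) / ((ℓ - 1 : ℕ) : ℝ)) ∧ ∀ᶠ w : IsDedekindDomain.HeightOneSpectrum (NumberField.RingOfIntegers L) in cofinite, ∃ (P : Polynomial (Valued.v : Valuation (PadicAlgCl ℓ) NNReal).valuationSubring) (a : (Valued.v : Valuation (PadicAlgCl ℓ) NNReal).valuationSubring), (ρ.restrictField L).HasFrobCharpolyAt w (P.map (Valued.v : Valuation (PadicAlgCl ℓ) NNReal).valuationSubring.subtype) ∧ P.map (IsLocalRing.residue (Valued.v : Valuation (PadicAlgCl ℓ) NNReal).valuationSubring) = (Polynomial.X - Polynomial.C (IsLocalRing.residue (Valued.v : Valuation (PadicAlgCl ℓ) NNReal).valuationSubring a)) ^ 2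

-- earlier OdlyzkoWorldDyadicLevelOneRankTwo (stmt-Langlands-28530, replaced 2026-08-30T06:01:21Z -> stmt-Langlands-28932): retired by None — ∀ (K : Type) [Field K] [NumberField K] (hcpt : Literature.NumberTheory.Automorphic.isCompact_glFiniteIntegralLevel 2 K) (ι : PadicAlgCl 2 ≃+* ℂ) (ρ : Literature.NumberTheory.GaloisRepresentations.FramedGaloisRep K (PadicAlgCl 2) 2), ρ.toGaloisRep.IsIrreducible 
/-- item stmt-Langlands-28932 · aside · rank 9 · open · by planner
sources: doi:10.1090/conm/174/01857, MoonTaguchi2008, Sengun2008, JonesRoberts2008, doi:10.1016/j.crma.2008.12.004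
[support] (RUNG of OW, BC5 plan-only; file as `aside` or as the first stub of OW's skeleton) the
dyadic level-one rank-2 shell of the world over ALL base fields: every irreducible pinned-geometric
2-adic ρ : Γ_K → GL₂(ℚ̄₂) unramified outside 2 that lies in the Odlyzko world is residually
automorphic. Finite and instrumentable (T-E/T-F/H23: the (†)₂ void over twelve quadratic fields
unconditionally; AT11: a targeted Hunter search over ℚ(√10), ℚ(√11) decides the wall fields); by
CEIL it contains B₂ over the five smallest fields. Outside S's known regime: automorphy of level-one
2-adic ρ of arbitrary weight and parity over quadratic K is not in print. [deps:
OdlyzkoWorldAutomorphy] [difficulty: L] TAGS (crit-1 CLEARED 2026-08-30T05:29:08Z STATUS L211,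
CRITIC-LEDGER row 50; REV 2 ERRATUM (Galois witness field) NODE L221, CLEARED 05:41:20Z L222, row
53): RUNG = ASIDE · BC5 PLAN-ONLY witness of weakness for OW ((n, ℓ, level) = (2, 2, one) shell, all
K; decided by an AT11 Hunter search — census instrument) · outside Langlands's known regime (even /
non-TR K included). · REV 2: Galois form; restated 1:1 stmt-Langlands-28530 → 28932; AT11 case (i)
instrumented (census kit j338735). -/
@[route_item "route-Langlands-OdlyzkoWorldSplit"]
def OdlyzkoWorldDyadicLevelOneRankTwo : Prop :=
  ∀ (K : Type) [Field K] [NumberField K] (hcpt : Literature.NumberTheory.Automorphic.isCompact_glFiniteIntegralLevel 2 K) (ι : PadicAlgCl 2 ≃+* ℂ) (ρ : Literature.NumberTheory.GaloisRepresentations.FramedGaloisRep K (PadicAlgCl 2) 2), ρ.toGaloisRep.IsIrreducible → ((∀ᶠ v : IsDedekindDomain.HeightOneSpectrum (NumberField.RingOfIntegers K) in cofinite, ρ.IsUnramifiedAt v) ∧ ∀ (v : IsDedekindDomain.HeightOneSpectrum (NumberField.RingOfIntegers K)) (hv : ((2 : ℕ) : NumberField.RingOfIntegers K) ∈ v.asIdeal),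 (Literature.NumberTheory.PAdicHodge.fontainePstAdicCompletion v 2 hv).IsDeRhamFramed (ρ.toLocal v)) → (∀ v : IsDedekindDomain.HeightOneSpectrum (NumberField.RingOfIntegers K), ((2 : ℕ) : NumberField.RingOfIntegers K) ∉ v.asIdeal → ρ.IsUnramifiedAt v) → (∃ (L : Type) (_ : Field L) (_ : NumberField L) (_ : Algebra K L), IsGalois K L ∧ (|(NumberField.discr L : ℝ)|) ^ ((1 : ℝ) / (Module.finrank ℚ L : ℝ)) < 4 * Real.pi * Real.exp (Real.eulerMascheroniConstant + (NumberField.InfinitePlace.nrRealPlaces L : ℝ) / (Module.finrank ℚ L : ℝ)) ∧ ∀ᶠ w : IsDedekindDomain.HeightOneSpectrum (NumberField.RingOfIntegers L) in cofinite, ∃ (P : Polynomial (Valued.v : Valuation (PadicAlgCl 2) NNReal).valuationSubring) (a : (Valued.v : Valuation (PadicAlgCl 2) NNReal).valuationSubring), (ρ.restrictField L).HasFrobCharpolyAt w (P.map (Valued.v : Valuation (PadicAlgCl 2) NNReal).valuationSubring.subtype) ∧ P.map (IsLocalRing.residue (Valued.v : Valuation (PadicAlgCl 2) NNReal).valuationSubring)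 = (Polynomial.X - Polynomial.C (IsLocalRing.residue (Valued.v : Valuation (PadicAlgCl 2) NNReal).valuationSubring a)) ^ 2) → ∃ π : Literature.NumberTheory.Automorphic.CuspidalAutomorphicRepData 2 K hcpt, π.1.IsLAlgebraic ∧ ∀ᶠ v : IsDedekindDomain.HeightOneSpectrum (NumberField.RingOfIntegers K) in cofinite, ρ.IsUnramifiedAt v ∧ (∃ α : Multiset ℂ, π.1.HasSatakeParamAt v α) ∧ ∀ α : Multiset ℂ, π.1.HasSatakeParamAt v α → ∃ P Q : Polynomial (Valued.v : Valuation (PadicAlgCl 2) NNReal).valuationSubring, ρ.HasFrobCharpolyAt v (P.map (Valued.v : Valuation (PadicAlgCl 2) NNReal).valuationSubring.subtype) ∧ Literature.NumberTheory.Automorphic.arithFrobPolyOfSatake ι v.residueCard 1 α = Q.map (Valued.v : Valuation (PadicAlgCl 2) NNReal).valuationSubring.subtype ∧ P.map (IsLocalRing.residue (Valued.v : Valuation (PadicAlgCl 2) NNReal).valuationSubring) = Q.map (IsLocalRing.residue (Valued.v : Valuation (PadicAlgCl 2) NNReal).valuationSubring)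

/-- item stmt-Langlands-28531 · assembly · rank 1 · open · by planner
sources: KhareWintenberger2009, Odlyzko1990, BuzzardGeeLMS2014
[assembly] OdlyzkoWorldAutomorphy → TransOdlyzkoAutomorphy → AutomorphyLifting →
SatakeAvatarExistence → PadicMemberCompatibility → CompatibilityAwayFromLR →
CanonicalReciprocityData → Langlands. -/
@[route_item "route-Langlands-OdlyzkoWorldSplit"]
def Assembly : Prop :=
  OdlyzkoWorldAutomorphy → TransOdlyzkoAutomorphy → AutomorphyLifting → SatakeAvatarExistence → PadicMemberCompatibility → CompatibilityAwayFromLR → CanonicalReciprocityData → _root_.Langlands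

/-! D-0027 §2.1 — DECIDING THEOREM (planner-authored via `route open/edit --closes-file`; by planner-decomp-langlands-writer-1-g2-0 2026-08-30T06:00:13Z):
its hypotheses are this route's items and its conclusion the sub-problem Statement (glue_lint), and it elaborates with this file. -/

@[closes "route-Langlands-OdlyzkoWorldSplit"] theorem closes (hOW : OdlyzkoWorldAutomorphy) (hRES : TransOdlyzkoAutomorphy) (hL : AutomorphyLifting)
    (hW : SatakeAvatarExistence) (hP : PadicMemberCompatibility) (hA : CompatibilityAwayFromLR)
    (hR : CanonicalReciprocityData) : _root_.Langlands := by
  -- `Assembly` (item) is literally the curried form of this theorem: prove it, then apply it (writer convention of the sibling routes).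
  suffices hAsm : Assembly from hAsm hOW hRES hL hW hP hA hR
  clear hOW hRES hL hW hP hA hR
  intro hOW hRES hL hW hP hA hR
  -- THE SEAM (excluded middle on the archimedean dial): a Serre_w instance is either in the Odlyzko world (OW answers) or not (RES, fed OW, answers).
  have hS : Summit.Langlands.Langlands.Theses.ResidualSplit.ResidualAutomorphy := by
    intro K _ _ n hcpt hn ℓ _ ι ρ hirr hgeo
    exact (Classical.em _).elim (hOW K n hcpt hn ℓ ι ρ hirr hgeo) (hRES hOW K n hcpt hn ℓ ι ρ hirr hgeo)
  -- then the route of record's deciding theorem verbatim (the inherited items re-declared in this route are the same terms).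
  exact Summit.Langlands.Langlands.Theses.ResidualSplit.closes hS hL hW hP hA hR

end Summit.Langlands.Langlands.Theses.OdlyzkoWorldSplit
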